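import Literature.Topology.FourManifolds.BandSumCommProofs
import Literature.Topology.FourManifolds.BandEdgeLift
import Literature.Topology.FourManifolds.MonotoneInverse
import Literature.Topology.FourManifolds.PlanarArchExplicit
import HarnessLib

/-!
# Band cores: the band of a band sum without the result knot

Topic `Literature/Topology/FourManifolds` (trunk T-4MAN); fact seat
`provefact-Literature.Topology.FourManifolds.Knot.exists_isBandSum` (`BandSum.lean`: **existence
of band sums** — two disjoint knots `K₁`, `K₂` have a band sum along a band avoiding a closed set
off the knots through which their base points are joined; Gompf–Stipsicz (1999), §5.1, Fig. 5.7;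
Kirby (1989), Ch. I §4, p. 10: "the band-connected sum can be done along any band").

The tree's `Literature.Topology.FourManifolds.BandData K₁ K₂ K avoid` records *both* the band
(a smooth map `band : ℝ² → 𝕊³`, an injective immersion on the collar square `squareNhd δ`, whose
left and right edge lines run along `K₁` upwards and along `K₂` downwards) *and* the result knot
`K` with its two planar arcs. The existence proof naturally splits in two:

1. construct a **band core** — the `K`-free part of `BandData` (this file's
   `Literature.Topology.FourManifolds.BandCore K₁ K₂ avoid`): the fields `band`, `δ`, `δ_pos`,
   `contMDiff`, `injOn`, `injective_mfderiv`, `disjoint_avoid`, `preimage_left`, `preimage_right`,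
   `orient_left`, `orient_right` of `BandData`, verbatim;
2. **rebuild** a knot along it: the tree's rebuild pipeline (`BandEdgeLift.lean`,
   `BandRebuildArches.lean`, `BandRebuildCurve.lean`, `SchubertNormalForm.lean` Part V,
   `BandData.rebuildData`) produces from band-sum data `b` a knot `b.rebuild` and a presentation
   `BandData A B (b.rebuild hAB) ∅` along the *same* band — and it reads only the eleven fields above
   (never `lowerArc`, `upperArc`, `range_diff`, `preimage_range`, `orient_result`). This file and
   `BandCoreRebuild.lean` re-run that pipeline verbatim over a band core, ending with
   `Literature.Topology.FourManifolds.BandCore.exists_isBandSum`: **every band core between disjoint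
   knots is the band of a band sum** — which reduces `Knot.exists_isBandSum` to a statement about
   the band alone.

## Contents

* `Literature.Topology.FourManifolds.BandCore K₁ K₂ avoid` (structure), the forgetful map
  `Literature.Topology.FourManifolds.BandData.toCore`, `BandCore.mono`;
* the band-only lemmas of `BandSumCommProofs.lean` (§ "The two arcs of a band sum":
  `contMDiff_band_comp`, `contDiff_coe_band`, `deriv_coe_band_comp`, `fderiv_coe_band_ne_zero`,
  `band_pt2_zero_mem`, `band_pt2_one_mem`) and of `BandEdgeLift.lean` (§ `BandData`: the edge
  curves `contMDiff_band_pt2`, `injOn_band_pt2`, `deriv_coe_band_pt2(_ne_zero)` and their lifts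
  `exists_edgeLift`, `exists_leftLift`, `exists_rightLift`), now in the namespace `BandCore`;
* `BandRebuildArches.lean` over `BandCore` — **Part I, edge coordinates**: the lifts `b.thetaA`,
  `b.thetaB` of the edge lines over the heights `[1/10, 9/10]` (strictly increasing / decreasing,
  `C^∞` inside, windows shorter than a period), their inverses `b.heightA`, `b.heightB`, the marks
  `b.alo < b.tlo < b.thi < b.ahi`, the affine `b.psi` (slope `b.lam`), `b.psiInv`, the margins
  `b.epsLo`, `b.epsHi`, the extended heights `b.fLo`, `b.gLo`, `b.fUp`, `b.gUp`; **Part II, the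
  arches** `b.cLo`, `b.cUp` with the junction lemmas `band_cLo_eq_A`, `band_cLo_eq_B`,
  `band_cUp_eq_A`, `band_cUp_eq_B` and the membership lemmas `cLo_mem`, `cUp_mem`.

Statements, names and proofs are those of the cited tree files (with `BandData A B K avoid`
replaced by `BandCore A B avoid`); everything here is proved, no named facts are introduced
(D-0026).

## References

* R. E. Gompf, A. I. Stipsicz, *4-Manifolds and Kirby Calculus*, GSM 20, AMS (1999), §5.1,
  Fig. 5.7. [GompfStipsicz1999]
* R. C. Kirby, *The Topology of 4-Manifolds*, LNM 1374, Springer (1989), Ch. I §4, p. 10 (held: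
  `book:kirby1989-topology-4-manifolds`, PDF p. 10). [Kirby1989]

## Design notes

* `BandCore` repeats the field names and docstrings of `BandData` so that the pipeline's proofs
  apply verbatim (dot notation on `b`); `BandData` itself is left untouched (it is used by 28 files).
* All statements are `[folklore]`; the proofs are those of the cited tree files.
-/

open scoped Manifold ContDiff Topology Real
open Function Set Metric

noncomputable section

namespace Literature.Topology.FourManifolds

/-- Local notation: `𝔼 n` is the model Euclidean space `EuclideanSpace ℝ (Fin n)`. -/
local notation "𝔼 " n:arg => EuclideanSpace ℝ (Fin n)

/-- Local notation: `𝕊 n` is the unit sphere in `EuclideanSpace ℝ (Fin (n + 1))`. -/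
local notation "𝕊 " n:arg => (Metric.sphere (0 : EuclideanSpace ℝ (Fin (n + 1))) 1)

/-! ## Band cores -/

/-- **Band core**: the band of a band sum of the (disjoint) knots `K₁`, `K₂`, avoiding the set
`avoid` — the `K`-free part of `Literature.Topology.FourManifolds.BandData` (see there for the
picture): a smooth map `band : ℝ² → 𝕊 3` which is an injective immersion on the open collar square
`squareNhd δ`, misses `avoid` there, meets `K₁` exactly in the left edge line `x₀ = 0` (traversed
upwards by `K₁`, `orient_left`) and `K₂` exactly in the right edge line `x₀ = 1` (traversed
downwards, `orient_right`). Gompf–Stipsicz (1999), §5.1, Fig. 5.7; Kirby (1989), Ch. I §4, p. 10.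
[cite: GompfStipsicz1999, §5.1] -/
structure BandCore (K₁ K₂ : Knot) (avoid : Set (𝕊 3)) where
  /-- The band, a smooth map `ℝ² → 𝕊 3` (only its restriction to `squareNhd δ` matters). -/
  band : 𝔼 2 → 𝕊 3
  /-- The width of the collar of the unit square on which `band` is an embedding. -/
  δ : ℝ
  /-- The collar width is positive. -/
  δ_pos : 0 < δ
  /-- The band map is `C^∞`. -/
  contMDiff : ContMDiff 𝓘(ℝ, 𝔼 2) (𝓡 3) ∞ band
  /-- The band map is injective on the square neighbourhood. -/
  injOn : InjOn band (squareNhd δ)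
  /-- The band map is an immersion on the square neighbourhood. -/
  injective_mfderiv : ∀ x ∈ squareNhd δ, Injective (mfderiv 𝓘(ℝ, 𝔼 2) (𝓡 3) band x)
  /-- The band misses `avoid`. -/
  disjoint_avoid : Disjoint (band '' squareNhd δ) avoid
  /-- `K₁` meets the band exactly in the left edge line `x₀ = 0`. -/
  preimage_left : band ⁻¹' range K₁ ∩ squareNhd δ = {x ∈ squareNhd δ | x 0 = 0}
  /-- `K₂` meets the band exactly in the right edge line `x₀ = 1`. -/
  preimage_right : band ⁻¹' range K₂ ∩ squareNhd δ = {x ∈ squareNhd δ | x 0 = 1}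
  /-- Orientation of `K₁` along the left edge: upwards (velocity of `K₁` at the mid-point
  `band (0, 1/2)` is a positive multiple of `∂band/∂x₁`, compared in `ℝ⁴ ⊇ 𝕊 3`). -/
  orient_left : ∃ θ c : ℝ, 0 < c ∧ K₁ (circlePoint θ) = band (pt2 0 2⁻¹) ∧
    deriv (fun t ↦ ((K₁ (circlePoint t) : 𝕊 3) : 𝔼 4)) θ =
      c • fderiv ℝ (fun x ↦ ((band x : 𝕊 3) : 𝔼 4)) (pt2 0 2⁻¹) (pt2 0 1)
  /-- Orientation of `K₂` along the right edge: downwards. -/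
  orient_right : ∃ θ c : ℝ, 0 < c ∧ K₂ (circlePoint θ) = band (pt2 1 2⁻¹) ∧
    deriv (fun t ↦ ((K₂ (circlePoint t) : 𝕊 3) : 𝔼 4)) θ =
      c • fderiv ℝ (fun x ↦ ((band x : 𝕊 3) : 𝔼 4)) (pt2 1 2⁻¹) (pt2 0 (-1))

/-- The band of band-sum data is a band core (forget the result knot and its arcs). [folklore] -/
def BandData.toCore {K₁ K₂ K : Knot} {avoid : Set (𝕊 3)} (b : BandData K₁ K₂ K avoid) :
    BandCore K₁ K₂ avoid where
  band := b.band
  δ := b.δ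
  δ_pos := b.δ_pos
  contMDiff := b.contMDiff
  injOn := b.injOn
  injective_mfderiv := b.injective_mfderiv
  disjoint_avoid := b.disjoint_avoid
  preimage_left := b.preimage_left
  preimage_right := b.preimage_right
  orient_left := b.orient_left
  orient_right := b.orient_right

/-- The band of `b.toCore` is the band of `b`. [folklore] -/
@[simp] theorem BandData.toCore_band {K₁ K₂ K : Knot} {avoid : Set (𝕊 3)}
    (b : BandData K₁ K₂ K avoid) : b.toCore.band = b.band := rfl

/-- The collar width of `b.toCore` is that of `b`. [folklore] -/
@[simp] theorem BandData.toCore_δ {K₁ K₂ K : Knot} {avoid : Set (𝕊 3)}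
    (b : BandData K₁ K₂ K avoid) : b.toCore.δ = b.δ := rfl

namespace BandCore

/-- A band core avoiding `avoid` also avoids any smaller set. [folklore] -/
def mono {K₁ K₂ : Knot} {avoid avoid' : Set (𝕊 3)} (b : BandCore K₁ K₂ avoid) (h : avoid' ⊆ avoid) :
    BandCore K₁ K₂ avoid' :=
  { b with disjoint_avoid := b.disjoint_avoid.mono_right h }

end BandCore

/-! ## The band-only lemmas of `BandSumCommProofs.lean` -/

namespace BandCore

variable {K₁ K₂ : Knot} {avoid : Set (sphere (0 : EuclideanSpace ℝ (Fin 4)) 1)}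
  (b : BandCore K₁ K₂ avoid)

/-- The band composed with a smooth planar curve is a smooth curve in `𝕊³`. [folklore] -/
theorem contMDiff_band_comp {γ : ℝ → EuclideanSpace ℝ (Fin 2)} (hγ : ContDiff ℝ ∞ γ) :
    ContMDiff 𝓘(ℝ, ℝ) (𝓡 3) ∞ (fun s ↦ b.band (γ s)) :=
  b.contMDiff.comp hγ.contMDiff

/-- The band read in the ambient `ℝ⁴ ⊇ 𝕊³` is `C^∞`. [folklore] -/
theorem contDiff_coe_band : ContDiff ℝ ∞ (fun x ↦ (b.band x : EuclideanSpace ℝ (Fin 4))) := by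
  have := fact_finrank_euclideanSpace_succ 3
  exact contMDiff_iff_contDiff.1 ((contMDiff_coe_sphere (m := ∞)).comp b.contMDiff)

/-- **Velocity of the band along a planar curve** (chain rule in `ℝ⁴`): the velocity of
`s ↦ band (γ s)` is the derivative of the band at `γ s` in the direction `γ' s`. [folklore] -/
theorem deriv_coe_band_comp {γ : ℝ → EuclideanSpace ℝ (Fin 2)} (hγ : ContDiff ℝ ∞ γ) (s : ℝ) :
    deriv (fun s ↦ (b.band (γ s) : EuclideanSpace ℝ (Fin 4))) s =
      fderiv ℝ (fun x ↦ (b.band x : EuclideanSpace ℝ (Fin 4))) (γ s) (deriv γ s) :=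
  fderiv_comp_deriv s (b.contDiff_coe_band.differentiable (by simp) _)
    (hγ.differentiable (by simp) s)

/-- **The band is an immersion on the square neighbourhood, read in `ℝ⁴`**: its derivative at a
point of `squareNhd δ` kills no nonzero vector (the differentials of `band` and of `𝕊³ ⊆ ℝ⁴` are
injective). [folklore] -/
theorem fderiv_coe_band_ne_zero {x : EuclideanSpace ℝ (Fin 2)} (hx : x ∈ squareNhd b.δ)
    {v : EuclideanSpace ℝ (Fin 2)} (hv : v ≠ 0) :
    fderiv ℝ (fun x ↦ (b.band x : EuclideanSpace ℝ (Fin 4))) x v ≠ 0 := by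
  have := fact_finrank_euclideanSpace_succ 3
  have hn : (∞ : ℕ∞ω) ≠ 0 := by simp
  rw [fderiv_comp_sphere_apply ((contMDiff_coe_sphere (m := ∞)).mdifferentiableAt hn)
    (b.contMDiff.mdifferentiableAt hn)]
  intro h
  have h1 := mfderiv_coe_sphere_injective (n := 3) (b.band x) (h.trans (map_zero _).symm)
  exact hv (b.injective_mfderiv x hx (h1.trans (map_zero _).symm))

/-- The left edge `band (0, y)`, `-δ ≤ y ≤ 1 + δ`, of the band lies on `K₁` (for `-δ < y < 1 + δ`
by `preimage_left`; at the two corners by closedness of `range K₁`). [folklore] -/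
theorem band_pt2_zero_mem {y : ℝ} (hy : y ∈ Icc (-b.δ) (1 + b.δ)) :
    b.band (pt2 0 y) ∈ range K₁ := by
  have hδ := b.δ_pos
  have hsub : (fun y ↦ b.band (pt2 0 y)) '' Ioo (-b.δ) (1 + b.δ) ⊆ range K₁ := by
    rintro _ ⟨y, hy, rfl⟩
    have hmem : pt2 0 y ∈ {x ∈ squareNhd b.δ | x 0 = 0} := by
      refine ⟨fun i ↦ ?_, rfl⟩
      fin_cases i
      · exact ⟨by simp; linarith, by simp; linarith⟩
      · simpa [pt2] using hy
    rw [← b.preimage_left] at hmem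
    exact hmem.1
  have h := image_closure_subset_closure_image (s := Ioo (-b.δ) (1 + b.δ))
    (b.contMDiff.continuous.comp (continuous_pt2_right 0))
  rw [closure_Ioo (by linarith : (-b.δ) ≠ 1 + b.δ)] at h
  exact K₁.isClosed_range.closure_subset_iff.2 hsub (h ⟨y, hy, rfl⟩)

/-- The right edge `band (1, y)`, `-δ ≤ y ≤ 1 + δ`, of the band lies on `K₂`. [folklore] -/
theorem band_pt2_one_mem {y : ℝ} (hy : y ∈ Icc (-b.δ) (1 + b.δ)) :
    b.band (pt2 1 y) ∈ range K₂ := by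
  have hδ := b.δ_pos
  have hsub : (fun y ↦ b.band (pt2 1 y)) '' Ioo (-b.δ) (1 + b.δ) ⊆ range K₂ := by
    rintro _ ⟨y, hy, rfl⟩
    have hmem : pt2 1 y ∈ {x ∈ squareNhd b.δ | x 0 = 1} := by
      refine ⟨fun i ↦ ?_, rfl⟩
      fin_cases i
      · exact ⟨by simp; linarith, by simp; linarith⟩
      · simpa [pt2] using hy
    rw [← b.preimage_right] at hmem
    exact hmem.1
  have h := image_closure_subset_closure_image (s := Ioo (-b.δ) (1 + b.δ))
    (b.contMDiff.continuous.comp (continuous_pt2_right 1))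
  rw [closure_Ioo (by linarith : (-b.δ) ≠ 1 + b.δ)] at h
  exact K₂.isClosed_range.closure_subset_iff.2 hsub (h ⟨y, hy, rfl⟩)

end BandCore

/-! ## The edge curves and their lifts (`BandEdgeLift.lean`, § `BandData`) -/

namespace BandCore

variable {K₁ K₂ : Knot} {avoid : Set (𝕊 3)} (b : BandCore K₁ K₂ avoid)

/-- The edge curves `y ↦ band (a, y)` are smooth (`BandCore.contMDiff_band_comp` of
`BandSumCommProofs.lean` at `γ = pt2 a`). [folklore] -/
theorem contMDiff_band_pt2 (a : ℝ) : ContMDiff 𝓘(ℝ, ℝ) (𝓡 3) ∞ fun y : ℝ ↦ b.band (pt2 a y) :=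
  b.contMDiff_band_comp (contDiff_pt2_right a)

/-- The edge curves are continuous. [folklore] -/
theorem continuous_band_pt2 (a : ℝ) : Continuous fun y : ℝ ↦ b.band (pt2 a y) :=
  (b.contMDiff_band_pt2 a).continuous

/-- The vertical lines of the band are injective on the parameter range of the square
neighbourhood. [folklore] -/
theorem injOn_band_pt2 {a : ℝ} (ha : a ∈ Ioo (-b.δ) (1 + b.δ)) :
    InjOn (fun y : ℝ ↦ b.band (pt2 a y)) (Ioo (-b.δ) (1 + b.δ)) := by
  intro y hy y' hy' h
  have := b.injOn (pt2_mem_squareNhd_iff.2 ⟨ha, hy⟩) (pt2_mem_squareNhd_iff.2 ⟨ha, hy'⟩) h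
  simpa [pt2_apply_one] using congrArg (fun x : 𝔼 2 ↦ x 1) this

/-- The velocity of the edge curve `y ↦ band (a, y) ∈ ℝ⁴` is `∂band/∂x₁ (a, y)`
(`BandCore.deriv_coe_band_comp` of `BandSumCommProofs.lean` at `γ = pt2 a`). [folklore] -/
theorem deriv_coe_band_pt2 (a y : ℝ) :
    deriv (fun t : ℝ ↦ ((b.band (pt2 a t) : 𝕊 3) : 𝔼 4)) y =
      fderiv ℝ (fun x ↦ ((b.band x : 𝕊 3) : 𝔼 4)) (pt2 a y) (pt2 0 1) := by
  rw [b.deriv_coe_band_comp (contDiff_pt2_right a) y, (hasDerivAt_pt2_right a y).deriv]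

/-- The edge curves are regular inside the band: `∂band/∂x₁ ≠ 0`
(`BandCore.fderiv_coe_band_ne_zero` of `BandSumCommProofs.lean`). [folklore] -/
theorem deriv_coe_band_pt2_ne_zero {a y : ℝ} (h : pt2 a y ∈ squareNhd b.δ) :
    deriv (fun t : ℝ ↦ ((b.band (pt2 a t) : 𝕊 3) : 𝔼 4)) y ≠ 0 := by
  rw [deriv_coe_band_pt2]
  refine b.fderiv_coe_band_ne_zero h fun h0 ↦ ?_
  have : (1 : ℝ) = 0 := by simpa [pt2_apply_one] using congrArg (fun x : 𝔼 2 ↦ x 1) h0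
  exact one_ne_zero this

/-! ### Lifting the edges -/

/-- **Lifting an edge of the band, with its orientation.** Let `L` be a knot containing the
edge line `y ↦ band (a, y)` (`-δ < y < 1 + δ`) and suppose the orientation clause: at the
midpoint `band (a, 1/2)` the velocity of `θ ↦ L (cos θ, sin θ)` is `c ∂band/∂x₁`.
Then over any `[y₀, y₁] ∋ 1/2` inside `(-δ, 1 + δ)` the edge lifts to `Θ` (continuous, `C^∞`
inside, `L (circlePt (Θ y)) = band (a, y)`), and `Θ` is strictly increasing with positive
derivative and window shorter than one period if `c > 0`, strictly decreasing with negative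
derivative if `c < 0`: the velocity of the edge is `Θ' · 2πc · ∂band/∂x₁ ≠ 0`. [folklore] -/
theorem exists_edgeLift {L : Knot} {a c θ : ℝ} (ha : a ∈ Ioo (-b.δ) (1 + b.δ))
    (hmem : ∀ y ∈ Ioo (-b.δ) (1 + b.δ), b.band (pt2 a y) ∈ range L)
    (hpt : L (circlePoint θ) = b.band (pt2 a 2⁻¹))
    (hder : deriv (fun t ↦ ((L (circlePoint t) : 𝕊 3) : 𝔼 4)) θ =
      c • fderiv ℝ (fun x ↦ ((b.band x : 𝕊 3) : 𝔼 4)) (pt2 a 2⁻¹) (pt2 0 1))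
    {y₀ y₁ : ℝ} (h₀ : -b.δ < y₀) (h₀' : y₀ < 2⁻¹) (h₁ : 2⁻¹ < y₁) (h₁' : y₁ < 1 + b.δ) :
    ∃ Θ : ℝ → ℝ, ContinuousOn Θ (Icc y₀ y₁) ∧ (∀ y ∈ Icc y₀ y₁, L (circlePt (Θ y)) = b.band (pt2 a y)) ∧
      (∀ y ∈ Ioo y₀ y₁, ContDiffAt ℝ ∞ Θ y) ∧
      (0 < c → StrictMonoOn Θ (Icc y₀ y₁) ∧ (∀ y ∈ Ioo y₀ y₁, 0 < deriv Θ y) ∧ Θ y₁ < Θ y₀ + 1) ∧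
      (c < 0 → StrictAntiOn Θ (Icc y₀ y₁) ∧ (∀ y ∈ Ioo y₀ y₁, deriv Θ y < 0) ∧ Θ y₀ < Θ y₁ + 1) := by
  set γ : ℝ → 𝕊 3 := fun y ↦ b.band (pt2 a y) with hγ
  have hy01 : y₀ < y₁ := by linarith
  have hsub : Icc y₀ y₁ ⊆ Ioo (-b.δ) (1 + b.δ) := fun y hy ↦ ⟨by linarith [hy.1], by linarith [hy.2]⟩
  have hsub' : Ioo y₀ y₁ ⊆ Ioo (-b.δ) (1 + b.δ) := fun y hy ↦ hsub (Ioo_subset_Icc_self hy)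
  obtain ⟨Θ, hΘc, heq, hsm, hmono⟩ := L.exists_lift_Icc (b.continuous_band_pt2 a) hy01
    (fun y hy ↦ hmem y (hsub hy))
  have hsmooth : ∀ y ∈ Ioo y₀ y₁, ContDiffAt ℝ ∞ Θ y := fun y hy ↦
    hsm y hy (b.contMDiff_band_pt2 a y)
  have hinj : InjOn γ (Ioo y₀ y₁) := (b.injOn_band_pt2 ha).mono hsub'
  have hmono' := hmono hinj
  have hhalf : (2⁻¹ : ℝ) ∈ Ioo y₀ y₁ := ⟨h₀', h₁⟩
  -- the chain rule along the lift
  have hrel : ∀ y ∈ Ioo y₀ y₁, deriv (fun t ↦ ((γ t : 𝕊 3) : 𝔼 4)) y =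
      deriv Θ y • deriv (Knot.curve L) (Θ y) := fun y hy ↦
    L.deriv_coe_eq_deriv_lift_smul (b.contMDiff_band_pt2 a y)
      (hΘc.continuousAt (Icc_mem_nhds hy.1 hy.2))
      (Filter.eventually_of_mem (Icc_mem_nhds hy.1 hy.2) fun s hs ↦ heq s hs)
  have hne : ∀ y ∈ Ioo y₀ y₁, deriv Θ y ≠ 0 := fun y hy h0 ↦ by
    have := hrel y hy
    rw [h0, zero_smul] at this
    exact b.deriv_coe_band_pt2_ne_zero (pt2_mem_squareNhd_iff.2 ⟨ha, hsub' hy⟩) this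
  -- the orientation clause pins the sign of `Θ' (1/2)`
  have hsign : deriv Θ 2⁻¹ * (2 * π * c) = 1 := by
    -- `Θ (1/2)` and `θ / 2π` are parameters of the same point of `L`
    have hθ : L (circlePt (Θ 2⁻¹)) = L (circlePt ((2 * π)⁻¹ * θ)) := by
      rw [heq _ (Ioo_subset_Icc_self hhalf), circlePt_eq_circlePoint,
        mul_inv_cancel_left₀ (by positivity : (2 * π : ℝ) ≠ 0), hpt]
    obtain ⟨m, hm⟩ := (L.apply_circlePt_eq_iff).1 hθ
    have hD : deriv (Knot.curve L) (Θ 2⁻¹) =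
        (2 * π * c) • fderiv ℝ (fun x ↦ ((b.band x : 𝕊 3) : 𝔼 4)) (pt2 a 2⁻¹) (pt2 0 1) := by
      rw [hm, L.deriv_curve_add_int]
      have h1 := L.deriv_coe_apply_circlePoint θ
      rw [hder] at h1
      -- `c • v = (2π)⁻¹ • D`, so `D = (2π c) • v`
      have h2 := congrArg (fun w : 𝔼 4 ↦ (2 * π) • w) h1
      simp only [smul_smul, mul_inv_cancel₀ (by positivity : (2 * π : ℝ) ≠ 0), one_smul] at h2
      rw [← h2]
    have h3 := hrel 2⁻¹ hhalf
    rw [hD, smul_smul, hγ, b.deriv_coe_band_pt2 a 2⁻¹] at h3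
    set v := fderiv ℝ (fun x ↦ ((b.band x : 𝕊 3) : 𝔼 4)) (pt2 a 2⁻¹) (pt2 0 1) with hv
    have hv0 : v ≠ 0 := by
      rw [hv, ← b.deriv_coe_band_pt2 a 2⁻¹]
      exact b.deriv_coe_band_pt2_ne_zero (pt2_mem_squareNhd_iff.2 ⟨ha, hsub' hhalf⟩)
    have h4 : (1 - deriv Θ 2⁻¹ * (2 * π * c)) • v = 0 := by
      rw [sub_smul, one_smul, ← h3, sub_self]
    have := (smul_eq_zero.1 h4).resolve_right hv0
    linarith
  -- no two parameters of `[y₀, y₁]` differ by a period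
  have hper : ∀ y ∈ Icc y₀ y₁, ∀ y' ∈ Icc y₀ y₁, Θ y' = Θ y + 1 → False := by
    intro y hy y' hy' h
    have : γ y' = γ y := by
      show b.band (pt2 a y') = b.band (pt2 a y)
      rw [← heq y hy, ← heq y' hy', h, L.apply_circlePt_eq_iff]
      exact ⟨1, by simp⟩
    have hyy' : y' = y := b.injOn_band_pt2 ha (hsub hy') (hsub hy) this
    rw [hyy'] at h
    linarith
  refine ⟨Θ, hΘc, heq, hsmooth, fun hcpos ↦ ?_, fun hcneg ↦ ?_⟩
  · -- `c > 0`: increasing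
    have hpos : 0 < deriv Θ 2⁻¹ := by
      by_contra hle
      have : deriv Θ 2⁻¹ * (2 * π * c) ≤ 0 :=
        mul_nonpos_of_nonpos_of_nonneg (not_lt.1 hle) (by positivity)
      linarith
    have hm : StrictMonoOn Θ (Icc y₀ y₁) := by
      rcases hmono' with h | h
      · exact h
      · exact absurd (deriv_nonpos_of_strictAntiOn (h.mono Ioo_subset_Icc_self) hhalf) (not_le.2 hpos)
    refine ⟨hm, fun y hy ↦ lt_of_le_of_ne
      (deriv_nonneg_of_strictMonoOn (hm.mono Ioo_subset_Icc_self) hy) (hne y hy).symm, ?_⟩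
    by_contra hle
    push Not at hle
    obtain ⟨y, hy, hyv⟩ : Θ y₀ + 1 ∈ Θ '' Icc y₀ y₁ :=
      intermediate_value_Icc hy01.le hΘc ⟨by linarith, hle⟩
    exact hper y₀ (left_mem_Icc.2 hy01.le) y hy hyv
  · -- `c < 0`: decreasing
    have hneg : deriv Θ 2⁻¹ < 0 := by
      by_contra hle
      have : deriv Θ 2⁻¹ * (2 * π * c) ≤ 0 :=
        mul_nonpos_of_nonneg_of_nonpos (not_lt.1 hle) (by nlinarith [Real.pi_pos])
      linarith
    have hm : StrictAntiOn Θ (Icc y₀ y₁) := by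
      rcases hmono' with h | h
      · exact absurd (deriv_nonneg_of_strictMonoOn (h.mono Ioo_subset_Icc_self) hhalf) (not_le.2 hneg)
      · exact h
    refine ⟨hm, fun y hy ↦ lt_of_le_of_ne
      (deriv_nonpos_of_strictAntiOn (hm.mono Ioo_subset_Icc_self) hy) (hne y hy), ?_⟩
    by_contra hle
    push Not at hle
    obtain ⟨y, hy, hyv⟩ : Θ y₁ + 1 ∈ Θ '' Icc y₀ y₁ :=
      intermediate_value_Icc' hy01.le hΘc ⟨by linarith, hle⟩
    exact hper y₁ (right_mem_Icc.2 hy01.le) y hy hyv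

/-- **The lift of the left edge.** For `-δ < y₀ < 1/2 < y₁ < 1 + δ` the left edge
`y ↦ band (0, y)` lifts through `K₁ ∘ circlePt` to a function `Θ`, continuous on `[y₀, y₁]` and
`C^∞` inside, **strictly increasing** with positive derivative (`orient_left`: `K₁` traverses
the left edge upwards) and window shorter than one period. [folklore] -/
theorem exists_leftLift {y₀ y₁ : ℝ} (h₀ : -b.δ < y₀) (h₀' : y₀ < 2⁻¹) (h₁ : 2⁻¹ < y₁)
    (h₁' : y₁ < 1 + b.δ) :
    ∃ Θ : ℝ → ℝ, ContinuousOn Θ (Icc y₀ y₁) ∧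
      (∀ y ∈ Icc y₀ y₁, K₁ (circlePt (Θ y)) = b.band (pt2 0 y)) ∧
      (∀ y ∈ Ioo y₀ y₁, ContDiffAt ℝ ∞ Θ y) ∧ StrictMonoOn Θ (Icc y₀ y₁) ∧
      (∀ y ∈ Ioo y₀ y₁, 0 < deriv Θ y) ∧ Θ y₁ < Θ y₀ + 1 := by
  obtain ⟨θ, c, hc, hpt, hder⟩ := b.orient_left
  have ha : (0 : ℝ) ∈ Ioo (-b.δ) (1 + b.δ) := ⟨by linarith [b.δ_pos], by linarith [b.δ_pos]⟩
  obtain ⟨Θ, hΘc, heq, hsm, hpos, -⟩ := b.exists_edgeLift ha (fun y hy ↦ b.band_pt2_zero_mem (Ioo_subset_Icc_self hy))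
    hpt hder h₀ h₀' h₁ h₁'
  obtain ⟨hm, hd, hw⟩ := hpos hc
  exact ⟨Θ, hΘc, heq, hsm, hm, hd, hw⟩

/-- **The lift of the right edge.** For `-δ < y₀ < 1/2 < y₁ < 1 + δ` the right edge
`y ↦ band (1, y)` lifts through `K₂ ∘ circlePt` to a function `Θ`, continuous on `[y₀, y₁]` and
`C^∞` inside, **strictly decreasing** with negative derivative (`orient_right`: `K₂` traverses
the right edge downwards) and window shorter than one period. [folklore] -/
theorem exists_rightLift {y₀ y₁ : ℝ} (h₀ : -b.δ < y₀) (h₀' : y₀ < 2⁻¹) (h₁ : 2⁻¹ < y₁)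
    (h₁' : y₁ < 1 + b.δ) :
    ∃ Θ : ℝ → ℝ, ContinuousOn Θ (Icc y₀ y₁) ∧
      (∀ y ∈ Icc y₀ y₁, K₂ (circlePt (Θ y)) = b.band (pt2 1 y)) ∧
      (∀ y ∈ Ioo y₀ y₁, ContDiffAt ℝ ∞ Θ y) ∧ StrictAntiOn Θ (Icc y₀ y₁) ∧
      (∀ y ∈ Ioo y₀ y₁, deriv Θ y < 0) ∧ Θ y₀ < Θ y₁ + 1 := by
  obtain ⟨θ, c, hc, hpt, hder⟩ := b.orient_right
  have ha : (1 : ℝ) ∈ Ioo (-b.δ) (1 + b.δ) := ⟨by linarith [b.δ_pos], by linarith [b.δ_pos]⟩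
  -- `c • ∂band (0, -1) = (-c) • ∂band (0, 1)`
  have hder' : deriv (fun t ↦ ((K₂ (circlePoint t) : 𝕊 3) : 𝔼 4)) θ =
      (-c) • fderiv ℝ (fun x ↦ ((b.band x : 𝕊 3) : 𝔼 4)) (pt2 1 2⁻¹) (pt2 0 1) := by
    rw [hder, neg_smul, ← smul_neg, ← map_neg]
    congr 2
    ext i
    fin_cases i <;> simp
  obtain ⟨Θ, hΘc, heq, hsm, -, hneg⟩ := b.exists_edgeLift ha (fun y hy ↦ b.band_pt2_one_mem (Ioo_subset_Icc_self hy))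
    hpt hder' h₀ h₀' h₁ h₁'
  obtain ⟨hm, hd, hw⟩ := hneg (neg_lt_zero.2 hc)
  exact ⟨Θ, hΘc, heq, hsm, hm, hd, hw⟩

end BandCore

/-! ## Rebuilding a knot along a band core, I–II (`BandRebuildArches.lean` over `BandCore`) -/

namespace BandCore

variable {A B : Knot} {avoid : Set (𝕊 3)} (b : BandCore A B avoid)

/-! ### Numerical facts about the height window `[1/10, 9/10]` -/

/-- The bottom of the height window lies above `-δ`. [folklore] -/
theorem tenth_gt_neg_delta : -b.δ < 10⁻¹ := by linarith [b.δ_pos]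

/-- The top of the height window lies below `1 + δ`. [folklore] -/
theorem nine_tenths_lt : (9 / 10 : ℝ) < 1 + b.δ := by linarith [b.δ_pos]

/-! ### The lifts of the two edges -/

/-- **The lift of the left edge** over the heights `[1/10, 9/10]`: `A (circlePt (thetaA y)) =
band (0, y)` (chosen from `BandCore.exists_leftLift`). [folklore] -/
def thetaA : ℝ → ℝ :=
  Classical.choose (b.exists_leftLift b.tenth_gt_neg_delta (by norm_num) (by norm_num) b.nine_tenths_lt)

/-- The defining properties of `thetaA`. [folklore] -/
theorem thetaA_spec :
    ContinuousOn b.thetaA (Icc 10⁻¹ (9 / 10)) ∧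
      (∀ y ∈ Icc (10⁻¹ : ℝ) (9 / 10), A (circlePt (b.thetaA y)) = b.band (pt2 0 y)) ∧
      (∀ y ∈ Ioo (10⁻¹ : ℝ) (9 / 10), ContDiffAt ℝ ∞ b.thetaA y) ∧
      StrictMonoOn b.thetaA (Icc 10⁻¹ (9 / 10)) ∧
      (∀ y ∈ Ioo (10⁻¹ : ℝ) (9 / 10), 0 < deriv b.thetaA y) ∧ b.thetaA (9 / 10) < b.thetaA 10⁻¹ + 1 :=
  Classical.choose_spec (b.exists_leftLift b.tenth_gt_neg_delta (by norm_num) (by norm_num) b.nine_tenths_lt)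

/-- `thetaA` is continuous on `[1/10, 9/10]`. [folklore] -/
theorem continuousOn_thetaA : ContinuousOn b.thetaA (Icc 10⁻¹ (9 / 10)) := b.thetaA_spec.1

/-- `thetaA` lifts the left edge: `A (circlePt (thetaA y)) = band (0, y)`. [folklore] -/
theorem apply_circlePt_thetaA {y : ℝ} (hy : y ∈ Icc (10⁻¹ : ℝ) (9 / 10)) :
    A (circlePt (b.thetaA y)) = b.band (pt2 0 y) := b.thetaA_spec.2.1 y hy

/-- `thetaA` is `C^∞` inside. [folklore] -/
theorem contDiffAt_thetaA {y : ℝ} (hy : y ∈ Ioo (10⁻¹ : ℝ) (9 / 10)) : ContDiffAt ℝ ∞ b.thetaA y :=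
  b.thetaA_spec.2.2.1 y hy

/-- `thetaA` is strictly increasing (`K₁` traverses the left edge upwards). [folklore] -/
theorem strictMonoOn_thetaA : StrictMonoOn b.thetaA (Icc 10⁻¹ (9 / 10)) := b.thetaA_spec.2.2.2.1

/-- `thetaA' > 0` inside. [folklore] -/
theorem deriv_thetaA_pos {y : ℝ} (hy : y ∈ Ioo (10⁻¹ : ℝ) (9 / 10)) : 0 < deriv b.thetaA y :=
  b.thetaA_spec.2.2.2.2.1 y hy

/-- The window of `thetaA` is shorter than one period. [folklore] -/
theorem thetaA_window : b.thetaA (9 / 10) < b.thetaA 10⁻¹ + 1 := b.thetaA_spec.2.2.2.2.2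

/-- **The lift of the right edge** over the heights `[1/10, 9/10]`: `B (circlePt (thetaB y)) =
band (1, y)` (chosen from `BandCore.exists_rightLift`). [folklore] -/
def thetaB : ℝ → ℝ :=
  Classical.choose (b.exists_rightLift b.tenth_gt_neg_delta (by norm_num) (by norm_num) b.nine_tenths_lt)

/-- The defining properties of `thetaB`. [folklore] -/
theorem thetaB_spec :
    ContinuousOn b.thetaB (Icc 10⁻¹ (9 / 10)) ∧
      (∀ y ∈ Icc (10⁻¹ : ℝ) (9 / 10), B (circlePt (b.thetaB y)) = b.band (pt2 1 y)) ∧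
      (∀ y ∈ Ioo (10⁻¹ : ℝ) (9 / 10), ContDiffAt ℝ ∞ b.thetaB y) ∧
      StrictAntiOn b.thetaB (Icc 10⁻¹ (9 / 10)) ∧
      (∀ y ∈ Ioo (10⁻¹ : ℝ) (9 / 10), deriv b.thetaB y < 0) ∧ b.thetaB 10⁻¹ < b.thetaB (9 / 10) + 1 :=
  Classical.choose_spec (b.exists_rightLift b.tenth_gt_neg_delta (by norm_num) (by norm_num) b.nine_tenths_lt)

/-- `thetaB` is continuous on `[1/10, 9/10]`. [folklore] -/
theorem continuousOn_thetaB : ContinuousOn b.thetaB (Icc 10⁻¹ (9 / 10)) := b.thetaB_spec.1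

/-- `thetaB` lifts the right edge: `B (circlePt (thetaB y)) = band (1, y)`. [folklore] -/
theorem apply_circlePt_thetaB {y : ℝ} (hy : y ∈ Icc (10⁻¹ : ℝ) (9 / 10)) :
    B (circlePt (b.thetaB y)) = b.band (pt2 1 y) := b.thetaB_spec.2.1 y hy

/-- `thetaB` is `C^∞` inside. [folklore] -/
theorem contDiffAt_thetaB {y : ℝ} (hy : y ∈ Ioo (10⁻¹ : ℝ) (9 / 10)) : ContDiffAt ℝ ∞ b.thetaB y :=
  b.thetaB_spec.2.2.1 y hy

/-- `thetaB` is strictly decreasing (`K₂` traverses the right edge downwards). [folklore] -/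
theorem strictAntiOn_thetaB : StrictAntiOn b.thetaB (Icc 10⁻¹ (9 / 10)) := b.thetaB_spec.2.2.2.1

/-- `thetaB' < 0` inside. [folklore] -/
theorem deriv_thetaB_neg {y : ℝ} (hy : y ∈ Ioo (10⁻¹ : ℝ) (9 / 10)) : deriv b.thetaB y < 0 :=
  b.thetaB_spec.2.2.2.2.1 y hy

/-- The window of `thetaB` is shorter than one period. [folklore] -/
theorem thetaB_window : b.thetaB 10⁻¹ < b.thetaB (9 / 10) + 1 := b.thetaB_spec.2.2.2.2.2

/-! ### Heights as functions of the parameters -/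

/-- **The height along the left edge as a function of the parameter of `A`**: the inverse of
`thetaA` on `[1/10, 9/10]`. [folklore] -/
def heightA : ℝ → ℝ := invFunOn b.thetaA (Icc 10⁻¹ (9 / 10))

/-- `heightA (thetaA y) = y` on `[1/10, 9/10]`. [folklore] -/
theorem heightA_thetaA {y : ℝ} (hy : y ∈ Icc (10⁻¹ : ℝ) (9 / 10)) : b.heightA (b.thetaA y) = y :=
  (MonoInverse (by norm_num) b.continuousOn_thetaA b.strictMonoOn_thetaA).1 y hy

/-- `thetaA (heightA s) = s` and `heightA s ∈ [1/10, 9/10]` on `[thetaA (1/10), thetaA (9/10)]`.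
[folklore] -/
theorem thetaA_heightA {s : ℝ} (hs : s ∈ Icc (b.thetaA 10⁻¹) (b.thetaA (9 / 10))) :
    b.thetaA (b.heightA s) = s ∧ b.heightA s ∈ Icc (10⁻¹ : ℝ) (9 / 10) :=
  (MonoInverse (by norm_num) b.continuousOn_thetaA b.strictMonoOn_thetaA).2.1 s hs

/-- `heightA` is strictly increasing on `[thetaA (1/10), thetaA (9/10)]`. [folklore] -/
theorem strictMonoOn_heightA : StrictMonoOn b.heightA (Icc (b.thetaA 10⁻¹) (b.thetaA (9 / 10))) :=
  (MonoInverse (by norm_num) b.continuousOn_thetaA b.strictMonoOn_thetaA).2.2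

/-- `heightA` is `C^∞` with positive derivative at the interior parameters `thetaA y`,
`1/10 < y < 9/10`. [folklore] -/
theorem contDiffAt_heightA {y : ℝ} (hy : y ∈ Ioo (10⁻¹ : ℝ) (9 / 10)) :
    ContDiffAt ℝ ∞ b.heightA (b.thetaA y) ∧ 0 < deriv b.heightA (b.thetaA y) := by
  obtain ⟨h1, h2⟩ := MonoInverse_smooth (by norm_num) b.continuousOn_thetaA b.strictMonoOn_thetaA
    (fun u hu ↦ b.contDiffAt_thetaA hu) (fun u hu ↦ b.deriv_thetaA_pos hu) y hy
  refine ⟨h1, ?_⟩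
  show 0 < deriv (invFunOn b.thetaA (Icc 10⁻¹ (9 / 10))) (b.thetaA y)
  rw [h2]; exact inv_pos.2 (b.deriv_thetaA_pos hy)

/-- Interior parameters are of the form `thetaA y` with `y` interior. [folklore] -/
theorem exists_eq_thetaA {s : ℝ} (hs : s ∈ Ioo (b.thetaA 10⁻¹) (b.thetaA (9 / 10))) :
    ∃ y ∈ Ioo (10⁻¹ : ℝ) (9 / 10), b.thetaA y = s := by
  obtain ⟨h1, h2⟩ := b.thetaA_heightA (Ioo_subset_Icc_self hs)
  refine ⟨b.heightA s, ⟨lt_of_le_of_ne h2.1 ?_, lt_of_le_of_ne h2.2 ?_⟩, h1⟩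
  · intro h; rw [← h] at h1; exact hs.1.ne' h1.symm
  · intro h; rw [h] at h1; exact hs.2.ne h1.symm

/-- `heightA` is `C^∞` with positive derivative at every interior point of the parameter window.
[folklore] -/
theorem contDiffAt_heightA' {s : ℝ} (hs : s ∈ Ioo (b.thetaA 10⁻¹) (b.thetaA (9 / 10))) :
    ContDiffAt ℝ ∞ b.heightA s ∧ 0 < deriv b.heightA s := by
  obtain ⟨y, hy, rfl⟩ := b.exists_eq_thetaA hs
  exact b.contDiffAt_heightA hy

/-- The left edge in the parameter of `A`: `band (0, heightA s) = A (circlePt s)` for `s` in the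
parameter window. [folklore] -/
theorem band_pt2_zero_heightA {s : ℝ} (hs : s ∈ Icc (b.thetaA 10⁻¹) (b.thetaA (9 / 10))) :
    b.band (pt2 0 (b.heightA s)) = A (circlePt s) := by
  obtain ⟨h1, h2⟩ := b.thetaA_heightA hs
  rw [← b.apply_circlePt_thetaA h2, h1]

/-- **The height along the right edge as a function of the parameter of `B`**: the inverse of
`thetaB` on `[1/10, 9/10]` (a decreasing function on `[thetaB (9/10), thetaB (1/10)]`). [folklore] -/
def heightB : ℝ → ℝ := invFunOn b.thetaB (Icc 10⁻¹ (9 / 10))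

/-- `heightB (thetaB y) = y` on `[1/10, 9/10]`. [folklore] -/
theorem heightB_thetaB {y : ℝ} (hy : y ∈ Icc (10⁻¹ : ℝ) (9 / 10)) : b.heightB (b.thetaB y) = y :=
  (AntiInverse (by norm_num) b.continuousOn_thetaB b.strictAntiOn_thetaB).1 y hy

/-- `thetaB (heightB s) = s` and `heightB s ∈ [1/10, 9/10]` on `[thetaB (9/10), thetaB (1/10)]`.
[folklore] -/
theorem thetaB_heightB {s : ℝ} (hs : s ∈ Icc (b.thetaB (9 / 10)) (b.thetaB 10⁻¹)) :
    b.thetaB (b.heightB s) = s ∧ b.heightB s ∈ Icc (10⁻¹ : ℝ) (9 / 10) :=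
  (AntiInverse (by norm_num) b.continuousOn_thetaB b.strictAntiOn_thetaB).2.1 s hs

/-- `heightB` is strictly decreasing on `[thetaB (9/10), thetaB (1/10)]`. [folklore] -/
theorem strictAntiOn_heightB : StrictAntiOn b.heightB (Icc (b.thetaB (9 / 10)) (b.thetaB 10⁻¹)) :=
  (AntiInverse (by norm_num) b.continuousOn_thetaB b.strictAntiOn_thetaB).2.2

/-- `heightB` is `C^∞` with negative derivative at the interior parameters `thetaB y`. [folklore] -/
theorem contDiffAt_heightB {y : ℝ} (hy : y ∈ Ioo (10⁻¹ : ℝ) (9 / 10)) :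
    ContDiffAt ℝ ∞ b.heightB (b.thetaB y) ∧ deriv b.heightB (b.thetaB y) < 0 := by
  obtain ⟨h1, h2⟩ := AntiInverse_smooth (by norm_num) b.continuousOn_thetaB b.strictAntiOn_thetaB
    (fun u hu ↦ b.contDiffAt_thetaB hu) (fun u hu ↦ b.deriv_thetaB_neg hu) y hy
  refine ⟨h1, ?_⟩
  show deriv (invFunOn b.thetaB (Icc 10⁻¹ (9 / 10))) (b.thetaB y) < 0
  rw [h2]; exact inv_lt_zero.2 (b.deriv_thetaB_neg hy)

/-- Interior parameters are of the form `thetaB y` with `y` interior. [folklore] -/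
theorem exists_eq_thetaB {s : ℝ} (hs : s ∈ Ioo (b.thetaB (9 / 10)) (b.thetaB 10⁻¹)) :
    ∃ y ∈ Ioo (10⁻¹ : ℝ) (9 / 10), b.thetaB y = s := by
  obtain ⟨h1, h2⟩ := b.thetaB_heightB (Ioo_subset_Icc_self hs)
  refine ⟨b.heightB s, ⟨lt_of_le_of_ne h2.1 ?_, lt_of_le_of_ne h2.2 ?_⟩, h1⟩
  · intro h; rw [← h] at h1; exact hs.2.ne (by rw [h1])
  · intro h; rw [h] at h1; exact hs.1.ne' (by rw [h1])

/-- `heightB` is `C^∞` with negative derivative at every interior point of its window. [folklore] -/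
theorem contDiffAt_heightB' {s : ℝ} (hs : s ∈ Ioo (b.thetaB (9 / 10)) (b.thetaB 10⁻¹)) :
    ContDiffAt ℝ ∞ b.heightB s ∧ deriv b.heightB s < 0 := by
  obtain ⟨y, hy, rfl⟩ := b.exists_eq_thetaB hs
  exact b.contDiffAt_heightB hy

/-- The right edge in the parameter of `B`: `band (1, heightB s) = B (circlePt s)`. [folklore] -/
theorem band_pt2_one_heightB {s : ℝ} (hs : s ∈ Icc (b.thetaB (9 / 10)) (b.thetaB 10⁻¹)) :
    b.band (pt2 1 (b.heightB s)) = B (circlePt s) := by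
  obtain ⟨h1, h2⟩ := b.thetaB_heightB hs
  rw [← b.apply_circlePt_thetaB h2, h1]

/-! ### Parameter marks on `A` and the affine reparametrisation of `B` -/

/-- The parameter of `A` at height `1/5` on the left edge (where the new lower arc leaves `A`).
[folklore] -/
def alo : ℝ := b.thetaA (1 / 5)

/-- The parameter of `A` at height `3/10` (end of the lower arch, start of the `B`-piece).
[folklore] -/
def tlo : ℝ := b.thetaA (3 / 10)

/-- The parameter of `A` at height `7/10` (end of the `B`-piece, start of the upper arch).
[folklore] -/
def thi : ℝ := b.thetaA (7 / 10)

/-- The parameter of `A` at height `4/5` on the left edge (where the new upper arc rejoins `A`).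
[folklore] -/
def ahi : ℝ := b.thetaA (4 / 5)

/-- Order of the marks: `thetaA (1/10) < thetaA (3/20) < alo < tlo < thi < ahi < thetaA (17/20) <
thetaA (9/10) < thetaA (1/10) + 1`. [folklore] -/
theorem marks_lt :
    b.thetaA 10⁻¹ < b.thetaA (3 / 20) ∧ b.thetaA (3 / 20) < b.alo ∧ b.alo < b.tlo ∧ b.tlo < b.thi ∧
      b.thi < b.ahi ∧ b.ahi < b.thetaA (17 / 20) ∧ b.thetaA (17 / 20) < b.thetaA (9 / 10) ∧
      b.thetaA (9 / 10) < b.thetaA 10⁻¹ + 1 := by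
  have h := b.strictMonoOn_thetaA
  refine ⟨h ?_ ?_ ?_, h ?_ ?_ ?_, h ?_ ?_ ?_, h ?_ ?_ ?_, h ?_ ?_ ?_, h ?_ ?_ ?_, h ?_ ?_ ?_,
    b.thetaA_window⟩ <;> norm_num [alo, tlo, thi, ahi]

/-- The parameter stretch of `B` covered by the new knot has positive length less than one:
`0 < thetaB (4/5) + 1 - thetaB (1/5) < 1`. [folklore] -/
theorem thetaB_stretch : 0 < b.thetaB (4 / 5) + 1 - b.thetaB (1 / 5) ∧ b.thetaB (4 / 5) < b.thetaB (1 / 5) := by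
  have h := b.strictAntiOn_thetaB
  have h1 : b.thetaB (1 / 5) ≤ b.thetaB 10⁻¹ := h.antitoneOn (by norm_num) (by norm_num) (by norm_num)
  have h2 : b.thetaB (9 / 10) ≤ b.thetaB (4 / 5) := h.antitoneOn (by norm_num) (by norm_num) (by norm_num)
  exact ⟨by linarith [b.thetaB_window], h (by norm_num) (by norm_num) (by norm_num)⟩

/-- The slope of the affine reparametrisation `psi`. [folklore] -/
def lam : ℝ := (b.thetaB (4 / 5) + 1 - b.thetaB (1 / 5)) / (b.thi - b.tlo)

/-- The slope is positive. [folklore] -/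
theorem lam_pos : 0 < b.lam :=
  div_pos b.thetaB_stretch.1 (by linarith [b.marks_lt.2.2.2.1])

/-- **The affine reparametrisation** carrying `[tlo, thi]` (parameters of `A`) onto
`[thetaB (1/5), thetaB (4/5) + 1]` (parameters of `B`: from height `1/5` on the right edge, down
and around `B`, to height `4/5`). [folklore] -/
def psi (t : ℝ) : ℝ := b.thetaB (1 / 5) + (t - b.tlo) * b.lam

/-- The inverse affine map of `psi`. [folklore] -/
def psiInv (s : ℝ) : ℝ := b.tlo + (s - b.thetaB (1 / 5)) / b.lam

/-- `psi tlo = thetaB (1/5)`. [folklore] -/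
@[simp] theorem psi_tlo : b.psi b.tlo = b.thetaB (1 / 5) := by simp [psi]

/-- `psi thi = thetaB (4/5) + 1`. [folklore] -/
theorem psi_thi : b.psi b.thi = b.thetaB (4 / 5) + 1 := by
  have h : b.thi - b.tlo ≠ 0 := by linarith [b.marks_lt.2.2.2.1]
  simp only [psi, lam]
  field_simp
  ring

/-- `psi (psiInv s) = s`. [folklore] -/
@[simp] theorem psi_psiInv (s : ℝ) : b.psi (b.psiInv s) = s := by
  simp only [psi, psiInv]; field_simp [b.lam_pos.ne']; ring

/-- `psiInv (psi t) = t`. [folklore] -/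
@[simp] theorem psiInv_psi (t : ℝ) : b.psiInv (b.psi t) = t := by
  simp only [psi, psiInv]; field_simp [b.lam_pos.ne']; ring

/-- `psi` is strictly increasing. [folklore] -/
theorem strictMono_psi : StrictMono b.psi := fun s t hst ↦ by
  simp only [psi]; nlinarith [b.lam_pos]

/-- `psiInv` is strictly increasing. [folklore] -/
theorem strictMono_psiInv : StrictMono b.psiInv := fun s t hst ↦ by
  simp only [psiInv]
  have := b.lam_pos
  gcongr

/-- `psi` is smooth. [folklore] -/
theorem contDiff_psi : ContDiff ℝ ∞ b.psi :=
  contDiff_const.add ((contDiff_id.sub contDiff_const).mul contDiff_const)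

/-- The derivative of `psi` is its slope. [folklore] -/
theorem hasDerivAt_psi (t : ℝ) : HasDerivAt b.psi b.lam t := by
  have h := (((hasDerivAt_id t).sub_const b.tlo).mul_const b.lam).const_add (b.thetaB (1 / 5))
  rw [one_mul] at h
  exact h

/-- `deriv psi = lam`. [folklore] -/
@[simp] theorem deriv_psi (t : ℝ) : deriv b.psi t = b.lam := (b.hasDerivAt_psi t).deriv

/-- `psi t − psi s = (t − s) · lam`. [folklore] -/
theorem psi_sub_psi (s t : ℝ) : b.psi t - b.psi s = (t - s) * b.lam := by simp only [psi]; ring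

/-! ### The margins `ε` of the two arches -/

/-- The margin of the lower arch: small compared with `tlo - alo` and with the parameter stretch
of `B` between heights `3/10` and `1/5`. [folklore] -/
def epsLo : ℝ := min ((b.tlo - b.alo) / 5) ((b.thetaB (1 / 5) - b.thetaB (3 / 10)) / (2 * b.lam))

/-- The margin of the upper arch. [folklore] -/
def epsHi : ℝ := min ((b.ahi - b.thi) / 5) ((b.thetaB (7 / 10) - b.thetaB (4 / 5)) / (2 * b.lam))

/-- `0 < epsLo ≤ (tlo - alo)/5` and `2 · epsLo · lam ≤ thetaB (1/5) - thetaB (3/10)`. [folklore] -/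
theorem epsLo_bounds : 0 < b.epsLo ∧ b.epsLo ≤ (b.tlo - b.alo) / 5 ∧
    2 * b.epsLo * b.lam ≤ b.thetaB (1 / 5) - b.thetaB (3 / 10) := by
  have h1 : b.alo < b.tlo := b.marks_lt.2.2.1
  have h2 : b.thetaB (3 / 10) < b.thetaB (1 / 5) :=
    b.strictAntiOn_thetaB (by norm_num) (by norm_num) (by norm_num)
  have hl := b.lam_pos
  refine ⟨lt_min (by linarith) (div_pos (by linarith) (by linarith)), min_le_left _ _, ?_⟩
  have : b.epsLo ≤ (b.thetaB (1 / 5) - b.thetaB (3 / 10)) / (2 * b.lam) := min_le_right _ _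
  rw [le_div_iff₀ (by linarith)] at this
  linarith

/-- `0 < epsHi ≤ (ahi - thi)/5` and `2 · epsHi · lam ≤ thetaB (7/10) - thetaB (4/5)`. [folklore] -/
theorem epsHi_bounds : 0 < b.epsHi ∧ b.epsHi ≤ (b.ahi - b.thi) / 5 ∧
    2 * b.epsHi * b.lam ≤ b.thetaB (7 / 10) - b.thetaB (4 / 5) := by
  have h1 : b.thi < b.ahi := b.marks_lt.2.2.2.2.1
  have h2 : b.thetaB (4 / 5) < b.thetaB (7 / 10) :=
    b.strictAntiOn_thetaB (by norm_num) (by norm_num) (by norm_num)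
  have hl := b.lam_pos
  refine ⟨lt_min (by linarith) (div_pos (by linarith) (by linarith)), min_le_left _ _, ?_⟩
  have : b.epsHi ≤ (b.thetaB (7 / 10) - b.thetaB (4 / 5)) / (2 * b.lam) := min_le_right _ _
  rw [le_div_iff₀ (by linarith)] at this
  linarith

/-! ### The height functions of the arches, extended to the whole line -/

/-- `heightA` is `C^∞` with positive derivative on the open parameter window, in the form of the
extension lemmas. [folklore] -/
theorem heightA_hyp : (∀ t ∈ Ioo (b.thetaA 10⁻¹) (b.thetaA (9 / 10)), ContDiffAt ℝ ∞ b.heightA t) ∧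
    ∀ t ∈ Ioo (b.thetaA 10⁻¹) (b.thetaA (9 / 10)), 0 < deriv b.heightA t :=
  ⟨fun _ ht ↦ (b.contDiffAt_heightA' ht).1, fun _ ht ↦ (b.contDiffAt_heightA' ht).2⟩

/-- **The height of the lower arch on the side of `A`**: a globally `C^∞` increasing extension of
`heightA` (unchanged on `[thetaA (3/20), thetaA (17/20)]`, affine of slope `1` far left).
[folklore] -/
def fLo : ℝ → ℝ :=
  Classical.choose (exists_increasing_extension_left b.marks_lt.1
    (b.marks_lt.2.1.trans (b.marks_lt.2.2.1.trans (b.marks_lt.2.2.2.1.trans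
      (b.marks_lt.2.2.2.2.1.trans b.marks_lt.2.2.2.2.2.1)))) b.marks_lt.2.2.2.2.2.2.1
    b.heightA_hyp.1 b.heightA_hyp.2)

/-- The defining properties of `fLo`. [folklore] -/
theorem fLo_spec : ContDiff ℝ ∞ b.fLo ∧
    (∀ t ∈ Icc (b.thetaA (3 / 20)) (b.thetaA (17 / 20)), b.fLo t = b.heightA t) ∧
    (∀ t, t ≤ b.thetaA (17 / 20) → 0 < deriv b.fLo t) ∧
    (∃ k, ∀ t, t ≤ b.thetaA 10⁻¹ → b.fLo t = t + k) ∧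
    (∀ m, m < b.heightA (b.thetaA (3 / 20)) → ∃ t, t < b.thetaA (3 / 20) ∧ b.fLo t = m) ∧
    ∀ t, b.thetaA (3 / 20) ≤ t → ∃ u ∈ Ioo (b.thetaA 10⁻¹) (b.thetaA (9 / 10)), b.fLo t = b.heightA u :=
  Classical.choose_spec (exists_increasing_extension_left b.marks_lt.1
    (b.marks_lt.2.1.trans (b.marks_lt.2.2.1.trans (b.marks_lt.2.2.2.1.trans
      (b.marks_lt.2.2.2.2.1.trans b.marks_lt.2.2.2.2.2.1)))) b.marks_lt.2.2.2.2.2.2.1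
    b.heightA_hyp.1 b.heightA_hyp.2)

/-- **The height of the upper arch on the side of `A`**: a globally `C^∞` increasing extension of
`heightA` to the right. [folklore] -/
def fUp : ℝ → ℝ :=
  Classical.choose (exists_increasing_extension_right b.marks_lt.1
    (b.marks_lt.2.1.trans (b.marks_lt.2.2.1.trans (b.marks_lt.2.2.2.1.trans
      (b.marks_lt.2.2.2.2.1.trans b.marks_lt.2.2.2.2.2.1)))) b.marks_lt.2.2.2.2.2.2.1
    b.heightA_hyp.1 b.heightA_hyp.2)

/-- The defining properties of `fUp`. [folklore] -/
theorem fUp_spec : ContDiff ℝ ∞ b.fUp ∧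
    (∀ t ∈ Icc (b.thetaA (3 / 20)) (b.thetaA (17 / 20)), b.fUp t = b.heightA t) ∧
    (∀ t, b.thetaA (3 / 20) ≤ t → 0 < deriv b.fUp t) ∧
    (∃ k, ∀ t, b.thetaA (9 / 10) ≤ t → b.fUp t = t + k) ∧
    (∀ m, b.heightA (b.thetaA (17 / 20)) < m → ∃ t, b.thetaA (17 / 20) < t ∧ b.fUp t = m) ∧
    ∀ t, t ≤ b.thetaA (17 / 20) → ∃ u ∈ Ioo (b.thetaA 10⁻¹) (b.thetaA (9 / 10)), b.fUp t = b.heightA u :=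
  Classical.choose_spec (exists_increasing_extension_right b.marks_lt.1
    (b.marks_lt.2.1.trans (b.marks_lt.2.2.1.trans (b.marks_lt.2.2.2.1.trans
      (b.marks_lt.2.2.2.2.1.trans b.marks_lt.2.2.2.2.2.1)))) b.marks_lt.2.2.2.2.2.2.1
    b.heightA_hyp.1 b.heightA_hyp.2)

/-- Order of the `B`-marks of the lower arch (read through `psiInv`): heights `2/5 > 7/20 > 3/20 >
1/10`. [folklore] -/
theorem marksB_lo_lt : b.psiInv (b.thetaB (2 / 5)) < b.psiInv (b.thetaB (7 / 20)) ∧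
    b.psiInv (b.thetaB (7 / 20)) < b.psiInv (b.thetaB (3 / 20)) ∧
    b.psiInv (b.thetaB (3 / 20)) < b.psiInv (b.thetaB 10⁻¹) := by
  have h := b.strictAntiOn_thetaB
  refine ⟨b.strictMono_psiInv (h ?_ ?_ ?_), b.strictMono_psiInv (h ?_ ?_ ?_),
    b.strictMono_psiInv (h ?_ ?_ ?_)⟩ <;> norm_num

/-- `t ↦ heightB (psi t)` is `C^∞` with negative derivative where `psi t` lies in the open window of
`thetaB`. [folklore] -/
theorem heightB_psi_hyp :
    (∀ t ∈ Ioo (b.psiInv (b.thetaB (2 / 5))) (b.psiInv (b.thetaB 10⁻¹)),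
      ContDiffAt ℝ ∞ (fun t ↦ b.heightB (b.psi t)) t) ∧
    ∀ t ∈ Ioo (b.psiInv (b.thetaB (2 / 5))) (b.psiInv (b.thetaB 10⁻¹)),
      deriv (fun t ↦ b.heightB (b.psi t)) t < 0 := by
  have hwin : ∀ t ∈ Ioo (b.psiInv (b.thetaB (2 / 5))) (b.psiInv (b.thetaB 10⁻¹)),
      b.psi t ∈ Ioo (b.thetaB (9 / 10)) (b.thetaB 10⁻¹) := fun t ht ↦ by
    have h1 := b.strictMono_psi ht.1
    have h2 := b.strictMono_psi ht.2
    rw [psi_psiInv] at h1 h2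
    exact ⟨(b.strictAntiOn_thetaB (by norm_num) (by norm_num) (by norm_num : (2 / 5 : ℝ) < 9 / 10)).trans h1, h2⟩
  refine ⟨fun t ht ↦ (b.contDiffAt_heightB' (hwin t ht)).1.comp t b.contDiff_psi.contDiffAt,
    fun t ht ↦ ?_⟩
  have hd : HasDerivAt (fun t ↦ b.heightB (b.psi t)) (deriv b.heightB (b.psi t) * b.lam) t :=
    ((b.contDiffAt_heightB' (hwin t ht)).1.differentiableAt (by simp)).hasDerivAt.comp t
      (b.hasDerivAt_psi t)
  rw [hd.deriv]
  exact mul_neg_of_neg_of_pos (b.contDiffAt_heightB' (hwin t ht)).2 b.lam_pos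

/-- **The height of the lower arch on the side of `B`**: a globally `C^∞` decreasing extension to
the right of `t ↦ heightB (psi t)` (unchanged for `psi t` between `thetaB (7/20)` and
`thetaB (3/20)`). [folklore] -/
def gLo : ℝ → ℝ :=
  Classical.choose (exists_decreasing_extension_right b.marksB_lo_lt.1 b.marksB_lo_lt.2.1
    b.marksB_lo_lt.2.2 b.heightB_psi_hyp.1 b.heightB_psi_hyp.2)

/-- The defining properties of `gLo`. [folklore] -/
theorem gLo_spec : ContDiff ℝ ∞ b.gLo ∧
    (∀ t ∈ Icc (b.psiInv (b.thetaB (7 / 20))) (b.psiInv (b.thetaB (3 / 20))),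
      b.gLo t = b.heightB (b.psi t)) ∧
    (∀ t, b.psiInv (b.thetaB (7 / 20)) ≤ t → deriv b.gLo t < 0) ∧
    (∃ k, ∀ t, b.psiInv (b.thetaB 10⁻¹) ≤ t → b.gLo t = -t + k) ∧
    (∀ m, m < b.heightB (b.psi (b.psiInv (b.thetaB (3 / 20)))) →
      ∃ t, b.psiInv (b.thetaB (3 / 20)) < t ∧ b.gLo t = m) ∧
    ∀ t, t ≤ b.psiInv (b.thetaB (3 / 20)) →
      ∃ u ∈ Ioo (b.psiInv (b.thetaB (2 / 5))) (b.psiInv (b.thetaB 10⁻¹)), b.gLo t = b.heightB (b.psi u) :=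
  Classical.choose_spec (exists_decreasing_extension_right b.marksB_lo_lt.1 b.marksB_lo_lt.2.1
    b.marksB_lo_lt.2.2 b.heightB_psi_hyp.1 b.heightB_psi_hyp.2)

/-- Order of the `B`-marks of the upper arch: heights `9/10 > 17/20 > 13/20 > 3/5` one period on.
[folklore] -/
theorem marksB_hi_lt : b.psiInv (b.thetaB (9 / 10) + 1) < b.psiInv (b.thetaB (17 / 20) + 1) ∧
    b.psiInv (b.thetaB (17 / 20) + 1) < b.psiInv (b.thetaB (13 / 20) + 1) ∧
    b.psiInv (b.thetaB (13 / 20) + 1) < b.psiInv (b.thetaB (3 / 5) + 1) := by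
  have h := b.strictAntiOn_thetaB
  have h1 : b.thetaB (9 / 10) < b.thetaB (17 / 20) := h (by norm_num) (by norm_num) (by norm_num)
  have h2 : b.thetaB (17 / 20) < b.thetaB (13 / 20) := h (by norm_num) (by norm_num) (by norm_num)
  have h3 : b.thetaB (13 / 20) < b.thetaB (3 / 5) := h (by norm_num) (by norm_num) (by norm_num)
  exact ⟨b.strictMono_psiInv (by linarith), b.strictMono_psiInv (by linarith),
    b.strictMono_psiInv (by linarith)⟩

/-- `t ↦ heightB (psi t - 1)` is `C^∞` with negative derivative where `psi t - 1` lies in the open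
window of `thetaB`. [folklore] -/
theorem heightB_psi_sub_one_hyp :
    (∀ t ∈ Ioo (b.psiInv (b.thetaB (9 / 10) + 1)) (b.psiInv (b.thetaB (3 / 5) + 1)),
      ContDiffAt ℝ ∞ (fun t ↦ b.heightB (b.psi t - 1)) t) ∧
    ∀ t ∈ Ioo (b.psiInv (b.thetaB (9 / 10) + 1)) (b.psiInv (b.thetaB (3 / 5) + 1)),
      deriv (fun t ↦ b.heightB (b.psi t - 1)) t < 0 := by
  have hwin : ∀ t ∈ Ioo (b.psiInv (b.thetaB (9 / 10) + 1)) (b.psiInv (b.thetaB (3 / 5) + 1)),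
      b.psi t - 1 ∈ Ioo (b.thetaB (9 / 10)) (b.thetaB 10⁻¹) := fun t ht ↦ by
    have h1 := b.strictMono_psi ht.1
    have h2 := b.strictMono_psi ht.2
    rw [psi_psiInv] at h1 h2
    refine ⟨by linarith, ?_⟩
    have := b.strictAntiOn_thetaB (by norm_num) (by norm_num) (by norm_num : (10⁻¹ : ℝ) < 3 / 5)
    linarith
  have hsm : ContDiff ℝ ∞ fun t ↦ b.psi t - 1 := b.contDiff_psi.sub contDiff_const
  refine ⟨fun t ht ↦ (b.contDiffAt_heightB' (hwin t ht)).1.comp t hsm.contDiffAt, fun t ht ↦ ?_⟩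
  have hd : HasDerivAt (fun t ↦ b.heightB (b.psi t - 1)) (deriv b.heightB (b.psi t - 1) * b.lam) t :=
    ((b.contDiffAt_heightB' (hwin t ht)).1.differentiableAt (by simp)).hasDerivAt.comp t
      ((b.hasDerivAt_psi t).sub_const 1)
  rw [hd.deriv]
  exact mul_neg_of_neg_of_pos (b.contDiffAt_heightB' (hwin t ht)).2 b.lam_pos

/-- **The height of the upper arch on the side of `B`**: a globally `C^∞` decreasing extension to
the left of `t ↦ heightB (psi t - 1)`. [folklore] -/
def gUp : ℝ → ℝ :=
  Classical.choose (exists_decreasing_extension_left b.marksB_hi_lt.1 b.marksB_hi_lt.2.1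
    b.marksB_hi_lt.2.2 b.heightB_psi_sub_one_hyp.1 b.heightB_psi_sub_one_hyp.2)

/-- The defining properties of `gUp`. [folklore] -/
theorem gUp_spec : ContDiff ℝ ∞ b.gUp ∧
    (∀ t ∈ Icc (b.psiInv (b.thetaB (17 / 20) + 1)) (b.psiInv (b.thetaB (13 / 20) + 1)),
      b.gUp t = b.heightB (b.psi t - 1)) ∧
    (∀ t, t ≤ b.psiInv (b.thetaB (13 / 20) + 1) → deriv b.gUp t < 0) ∧
    (∃ k, ∀ t, t ≤ b.psiInv (b.thetaB (9 / 10) + 1) → b.gUp t = -t + k) ∧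
    (∀ m, b.heightB (b.psi (b.psiInv (b.thetaB (17 / 20) + 1)) - 1) < m →
      ∃ t, t < b.psiInv (b.thetaB (17 / 20) + 1) ∧ b.gUp t = m) ∧
    ∀ t, b.psiInv (b.thetaB (17 / 20) + 1) ≤ t →
      ∃ u ∈ Ioo (b.psiInv (b.thetaB (9 / 10) + 1)) (b.psiInv (b.thetaB (3 / 5) + 1)),
        b.gUp t = b.heightB (b.psi u - 1) :=
  Classical.choose_spec (exists_decreasing_extension_left b.marksB_hi_lt.1 b.marksB_hi_lt.2.1
    b.marksB_hi_lt.2.2 b.heightB_psi_sub_one_hyp.1 b.heightB_psi_sub_one_hyp.2)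

/-! ### The lower arch -/

/-- The hypotheses of `exists_planarArch` for the lower arch. [folklore] -/
theorem cLo_hyp : 0 < b.epsLo ∧ b.alo + 2 * b.epsLo < b.tlo - 2 * b.epsLo ∧
    (∀ θ, θ ≤ b.alo + 2 * b.epsLo → 0 < deriv b.fLo θ) ∧
    (∀ θ, b.tlo - 2 * b.epsLo ≤ θ → deriv b.gLo θ < 0) := by
  obtain ⟨hε, hε1, hε2⟩ := b.epsLo_bounds
  have hm := b.marks_lt
  refine ⟨hε, by linarith, fun θ hθ ↦ b.fLo_spec.2.2.1 θ (by linarith), fun θ hθ ↦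
    b.gLo_spec.2.2.1 θ ?_⟩
  -- `psiInv (thetaB (7/20)) ≤ tlo - 2ε`, i.e. `thetaB (7/20) ≤ psi (tlo - 2ε)`
  have h1 : b.thetaB (7 / 20) < b.thetaB (3 / 10) :=
    b.strictAntiOn_thetaB (by norm_num) (by norm_num) (by norm_num)
  have h2 : b.psi (b.tlo - 2 * b.epsLo) = b.thetaB (1 / 5) - 2 * b.epsLo * b.lam := by
    simp only [psi]; ring
  have h3 : b.psiInv (b.thetaB (7 / 20)) ≤ b.tlo - 2 * b.epsLo := by
    rw [← b.psiInv_psi (b.tlo - 2 * b.epsLo)]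
    exact (b.strictMono_psiInv.le_iff_le).2 (by rw [h2]; linarith)
  linarith

/-- **The lower arch** of the rebuilt knot: the explicit planar arch `planarArch alo tlo epsLo fLo gLo`
(`PlanarArchExplicit.lean`; formerly chosen from `exists_planarArch`, same properties `cLo_spec`).
[folklore] -/
def cLo : ℝ → 𝔼 2 :=
  planarArch b.alo b.tlo b.epsLo b.fLo b.gLo

/-- The lower arch is the explicit planar arch (definitional). [folklore] -/
theorem cLo_eq_planarArch : b.cLo = planarArch b.alo b.tlo b.epsLo b.fLo b.gLo := rfl

/-- The defining properties of `cLo`. [folklore] -/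
theorem cLo_spec : ContDiff ℝ ∞ b.cLo ∧
    (∀ t, t ≤ b.alo + b.epsLo → b.cLo t = pt2 0 (b.fLo t)) ∧
    (∀ t, b.tlo - b.epsLo ≤ t → b.cLo t = pt2 1 (b.gLo t)) ∧
    (∀ t ∈ Ioo (b.alo + b.epsLo) (b.tlo - b.epsLo), b.cLo t 0 ∈ Ioo (0 : ℝ) 1) ∧
    (∀ t, b.cLo t 0 ∈ Icc (0 : ℝ) 1) ∧ (∀ t, b.cLo t 1 ∈ uIcc (b.fLo t) (b.gLo t)) ∧
    Injective b.cLo ∧ ∀ t, deriv b.cLo t ≠ 0 :=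
  planarArch_spec b.cLo_hyp.1 b.cLo_hyp.2.1 b.fLo_spec.1 b.gLo_spec.1 b.cLo_hyp.2.2.1 b.cLo_hyp.2.2.2

/-- `heightA` at the marks. [folklore] -/
theorem heightA_marks : b.heightA b.alo = 1 / 5 ∧ b.heightA b.tlo = 3 / 10 ∧
    b.heightA b.thi = 7 / 10 ∧ b.heightA b.ahi = 4 / 5 :=
  ⟨b.heightA_thetaA (by norm_num), b.heightA_thetaA (by norm_num), b.heightA_thetaA (by norm_num),
    b.heightA_thetaA (by norm_num)⟩

/-- On `[thetaA (3/20), tlo]` the height of the lower arch on the `A`-side is `heightA`, with values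
in `[3/20, 3/10]`. [folklore] -/
theorem fLo_eq_heightA {t : ℝ} (ht : t ∈ Icc (b.thetaA (3 / 20)) b.tlo) :
    b.fLo t = b.heightA t ∧ b.heightA t ∈ Icc (3 / 20 : ℝ) (3 / 10) := by
  have hm := b.marks_lt
  have h1 := b.fLo_spec.2.1 t ⟨ht.1, by linarith [ht.2]⟩
  refine ⟨h1, ?_⟩
  have hmono := b.strictMonoOn_heightA.monotoneOn
  have ha : b.heightA (b.thetaA (3 / 20)) = 3 / 20 := b.heightA_thetaA (by norm_num)
  constructor
  · rw [← ha]
    exact hmono ⟨hm.1.le, by linarith⟩ ⟨by linarith [ht.1], by linarith [ht.2]⟩ ht.1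
  · rw [← b.heightA_marks.2.1]
    exact hmono ⟨by linarith [ht.1], by linarith [ht.2]⟩ ⟨by linarith, by linarith⟩ ht.2

/-- Below `psiInv (thetaB (3/20))` the height of the lower arch on the `B`-side lies in
`(1/10, 2/5)`. [folklore] -/
theorem gLo_mem {t : ℝ} (ht : t ≤ b.psiInv (b.thetaB (3 / 20))) : b.gLo t ∈ Ioo (10⁻¹ : ℝ) (2 / 5) := by
  obtain ⟨u, hu, hgu⟩ := b.gLo_spec.2.2.2.2.2 t ht
  rw [hgu]
  have h1 := b.strictMono_psi hu.1
  have h2 := b.strictMono_psi hu.2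
  rw [psi_psiInv] at h1 h2
  have hwin : b.psi u ∈ Icc (b.thetaB (9 / 10)) (b.thetaB 10⁻¹) :=
    ⟨((b.strictAntiOn_thetaB (by norm_num) (by norm_num) (by norm_num : (2 / 5 : ℝ) < 9 / 10)).trans h1).le,
      h2.le⟩
  have hanti := b.strictAntiOn_heightB
  have e1 : b.heightB (b.thetaB (2 / 5)) = 2 / 5 := b.heightB_thetaB (by norm_num)
  have e2 : b.heightB (b.thetaB 10⁻¹) = 10⁻¹ := b.heightB_thetaB (by norm_num)
  have hm4 : b.thetaB (2 / 5) ∈ Icc (b.thetaB (9 / 10)) (b.thetaB 10⁻¹) :=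
    ⟨(b.strictAntiOn_thetaB (by norm_num) (by norm_num) (by norm_num : (2 / 5 : ℝ) < 9 / 10)).le,
      (b.strictAntiOn_thetaB (by norm_num) (by norm_num) (by norm_num : (10⁻¹ : ℝ) < 2 / 5)).le⟩
  have hm1 : b.thetaB 10⁻¹ ∈ Icc (b.thetaB (9 / 10)) (b.thetaB 10⁻¹) :=
    ⟨(b.strictAntiOn_thetaB (by norm_num) (by norm_num) (by norm_num : (10⁻¹ : ℝ) < 9 / 10)).le, le_rfl⟩
  constructor
  · rw [← e2]; exact hanti hwin hm1 h2
  · rw [← e1]; exact hanti hm4 hwin h1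

/-- `tlo ≤ psiInv (thetaB (3/20))` and `psiInv (thetaB (7/20)) ≤ tlo - epsLo`. [folklore] -/
theorem tlo_marksB : b.tlo < b.psiInv (b.thetaB (3 / 20)) ∧ b.psiInv (b.thetaB (7 / 20)) ≤ b.tlo - b.epsLo := by
  obtain ⟨hε, hε1, hε2⟩ := b.epsLo_bounds
  have hl := b.lam_pos
  constructor
  · rw [← b.psiInv_psi b.tlo, psi_tlo]
    exact b.strictMono_psiInv (b.strictAntiOn_thetaB (by norm_num) (by norm_num) (by norm_num))
  · have h1 : b.thetaB (7 / 20) < b.thetaB (3 / 10) :=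
      b.strictAntiOn_thetaB (by norm_num) (by norm_num) (by norm_num)
    have h2 : b.psi (b.tlo - b.epsLo) = b.thetaB (1 / 5) - b.epsLo * b.lam := by simp only [psi]; ring
    rw [← b.psiInv_psi (b.tlo - b.epsLo)]
    exact (b.strictMono_psiInv.le_iff_le).2 (by rw [h2]; nlinarith)

/-- **Lower junction with `A`.** For `t ∈ [thetaA (3/20), alo + epsLo]` the band image of the lower
arch is the point of `A` with parameter `t`: `band (cLo t) = A (circlePt t)`. [folklore] -/
theorem band_cLo_eq_A {t : ℝ} (ht : t ∈ Icc (b.thetaA (3 / 20)) (b.alo + b.epsLo)) :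
    b.band (b.cLo t) = A (circlePt t) := by
  have hm := b.marks_lt
  obtain ⟨hε, hε1, -⟩ := b.epsLo_bounds
  rw [b.cLo_spec.2.1 t ht.2, (b.fLo_eq_heightA ⟨ht.1, by linarith [ht.2]⟩).1,
    b.band_pt2_zero_heightA ⟨by linarith [ht.1], by linarith [ht.2]⟩]

/-- **Lower junction with `B`.** For `t ∈ [tlo - epsLo, psiInv (thetaB (3/20))]` the band image of
the lower arch is the point of `B` with parameter `psi t`: `band (cLo t) = B (circlePt (psi t))`.
[folklore] -/
theorem band_cLo_eq_B {t : ℝ} (ht : t ∈ Icc (b.tlo - b.epsLo) (b.psiInv (b.thetaB (3 / 20)))) :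
    b.band (b.cLo t) = B (circlePt (b.psi t)) := by
  obtain ⟨h1, h2⟩ := b.tlo_marksB
  rw [b.cLo_spec.2.2.1 t ht.1, b.gLo_spec.2.1 t ⟨by linarith [ht.1], ht.2⟩]
  apply b.band_pt2_one_heightB
  have hs1 := b.strictMono_psi.monotone ht.2
  have hs0 : b.psi (b.psiInv (b.thetaB (7 / 20))) ≤ b.psi t := b.strictMono_psi.monotone (by linarith [ht.1])
  rw [psi_psiInv] at hs1 hs0
  exact ⟨(b.strictAntiOn_thetaB (by norm_num) (by norm_num) (by norm_num : (7 / 20 : ℝ) < 9 / 10)).le.trans hs0,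
    hs1.trans (b.strictAntiOn_thetaB (by norm_num) (by norm_num) (by norm_num : (10⁻¹ : ℝ) < 3 / 20)).le⟩

/-- **Heights of the lower arch over `[alo, tlo]`** lie in `(1/10, 2/5)`, and the arch lies in the
square neighbourhood. [folklore] -/
theorem cLo_mem {t : ℝ} (ht : t ∈ Icc b.alo b.tlo) :
    b.cLo t ∈ squareNhd b.δ ∧ b.cLo t 1 ∈ Ioo (10⁻¹ : ℝ) (2 / 5) := by
  have hm := b.marks_lt
  have hδ := b.δ_pos
  have hx0 := b.cLo_spec.2.2.2.2.1 t
  have hx1 := b.cLo_spec.2.2.2.2.2.1 t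
  obtain ⟨hf, hfm⟩ := b.fLo_eq_heightA ⟨by linarith [ht.1], ht.2⟩
  have hg := b.gLo_mem (ht.2.trans b.tlo_marksB.1.le)
  have hx1' : b.cLo t 1 ∈ Ioo (10⁻¹ : ℝ) (2 / 5) := by
    rw [hf, mem_uIcc] at hx1
    rcases hx1 with h | h <;> constructor <;> linarith [h.1, h.2, hfm.1, hfm.2, hg.1, hg.2]
  refine ⟨?_, hx1'⟩
  rw [mem_squareNhd_iff, Fin.forall_fin_two]
  exact ⟨⟨by linarith [hx0.1], by linarith [hx0.2]⟩, ⟨by linarith [hx1'.1], by linarith [hx1'.2]⟩⟩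

/-! ### The upper arch -/

/-- `thi` versus the `B`-marks of the upper arch: `psiInv (thetaB (17/20) + 1) < thi` and
`thi + epsHi ≤ psiInv (thetaB (13/20) + 1)` (indeed `psi (thi + 2 epsHi) ≤ thetaB (7/10) + 1`).
[folklore] -/
theorem thi_marksB : b.psiInv (b.thetaB (17 / 20) + 1) < b.thi ∧
    b.thi + 2 * b.epsHi ≤ b.psiInv (b.thetaB (13 / 20) + 1) := by
  obtain ⟨hε, hε1, hε2⟩ := b.epsHi_bounds
  have hl := b.lam_pos
  constructor
  · rw [← b.psiInv_psi b.thi, psi_thi]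
    have h45 : b.thetaB (17 / 20) < b.thetaB (4 / 5) :=
      b.strictAntiOn_thetaB (by norm_num) (by norm_num) (by norm_num)
    exact b.strictMono_psiInv (by linarith)
  · have h1 : b.thetaB (7 / 10) < b.thetaB (13 / 20) :=
      b.strictAntiOn_thetaB (by norm_num) (by norm_num) (by norm_num)
    have h2 : b.psi (b.thi + 2 * b.epsHi) = b.thetaB (4 / 5) + 1 + 2 * b.epsHi * b.lam := by
      have := b.psi_sub_psi b.thi (b.thi + 2 * b.epsHi)
      rw [psi_thi] at this
      linarith
    rw [← b.psiInv_psi (b.thi + 2 * b.epsHi)]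
    exact (b.strictMono_psiInv.le_iff_le).2 (by rw [h2]; linarith)

/-- The hypotheses of `exists_planarArch` for the upper arch, in the reversed parameter `v = -t`.
[folklore] -/
theorem cUp_hyp : 0 < b.epsHi ∧ -b.ahi + 2 * b.epsHi < -b.thi - 2 * b.epsHi ∧
    (∀ v, v ≤ -b.ahi + 2 * b.epsHi → 0 < deriv (fun v ↦ -b.fUp (-v)) v) ∧
    (∀ v, -b.thi - 2 * b.epsHi ≤ v → deriv (fun v ↦ -b.gUp (-v)) v < 0) := by
  obtain ⟨hε, hε1, hε2⟩ := b.epsHi_bounds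
  have hm := b.marks_lt
  obtain ⟨-, h2⟩ := b.thi_marksB
  refine ⟨hε, by linarith, fun v hv ↦ ?_, fun v hv ↦ ?_⟩
  · rw [deriv.fun_neg, deriv_comp_neg, neg_neg]
    exact b.fUp_spec.2.2.1 (-v) (by linarith)
  · rw [deriv.fun_neg, deriv_comp_neg, neg_neg]
    exact b.gUp_spec.2.2.1 (-v) (by linarith)

/-- The auxiliary arch of the upper arc in the reversed parameter: the explicit planar arch
`planarArch (-ahi) (-thi) epsHi (v ↦ -fUp (-v)) (v ↦ -gUp (-v))` (`PlanarArchExplicit.lean`; formerly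
chosen from `exists_planarArch`, same properties `cUpAux_spec`). [folklore] -/
def cUpAux : ℝ → 𝔼 2 :=
  planarArch (-b.ahi) (-b.thi) b.epsHi (fun v ↦ -b.fUp (-v)) (fun v ↦ -b.gUp (-v))

/-- The auxiliary upper arch is the explicit planar arch (definitional). [folklore] -/
theorem cUpAux_eq_planarArch :
    b.cUpAux = planarArch (-b.ahi) (-b.thi) b.epsHi (fun v ↦ -b.fUp (-v)) (fun v ↦ -b.gUp (-v)) := rfl

/-- The defining properties of `cUpAux`. [folklore] -/
theorem cUpAux_spec : ContDiff ℝ ∞ b.cUpAux ∧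
    (∀ v, v ≤ -b.ahi + b.epsHi → b.cUpAux v = pt2 0 (-b.fUp (-v))) ∧
    (∀ v, -b.thi - b.epsHi ≤ v → b.cUpAux v = pt2 1 (-b.gUp (-v))) ∧
    (∀ v ∈ Ioo (-b.ahi + b.epsHi) (-b.thi - b.epsHi), b.cUpAux v 0 ∈ Ioo (0 : ℝ) 1) ∧
    (∀ v, b.cUpAux v 0 ∈ Icc (0 : ℝ) 1) ∧ (∀ v, b.cUpAux v 1 ∈ uIcc (-b.fUp (-v)) (-b.gUp (-v))) ∧
    Injective b.cUpAux ∧ ∀ v, deriv b.cUpAux v ≠ 0 :=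
  planarArch_spec b.cUp_hyp.1 b.cUp_hyp.2.1 (b.fUp_spec.1.comp contDiff_neg).neg
    (b.gUp_spec.1.comp contDiff_neg).neg b.cUp_hyp.2.2.1 b.cUp_hyp.2.2.2

/-- **The upper arch** of the rebuilt knot: the auxiliary arch read backwards with the height
reflected back, `cUp t = (cUpAux (-t))₀, -(cUpAux (-t))₁)`. [folklore] -/
def cUp (t : ℝ) : 𝔼 2 := pt2 (b.cUpAux (-t) 0) (-(b.cUpAux (-t) 1))

/-- First coordinate of the upper arch. [folklore] -/
@[simp] theorem cUp_apply_zero (t : ℝ) : b.cUp t 0 = b.cUpAux (-t) 0 := rfl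

/-- Second coordinate of the upper arch. [folklore] -/
@[simp] theorem cUp_apply_one (t : ℝ) : b.cUp t 1 = -(b.cUpAux (-t) 1) := rfl

/-- Coordinates of a smooth planar curve are smooth. [folklore] -/
theorem contDiff_apply_of_contDiff {c : ℝ → 𝔼 2} (hc : ContDiff ℝ ∞ c) (i : Fin 2) :
    ContDiff ℝ ∞ fun t ↦ c t i :=
  contDiff_euclidean.1 hc i

/-- The upper arch is `C^∞`. [folklore] -/
theorem contDiff_cUp : ContDiff ℝ ∞ b.cUp := by
  rw [contDiff_euclidean]
  intro i
  fin_cases i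
  · exact (contDiff_apply_of_contDiff b.cUpAux_spec.1 0).comp contDiff_neg
  · exact ((contDiff_apply_of_contDiff b.cUpAux_spec.1 1).comp contDiff_neg).neg

/-- Near `ahi` the upper arch runs up the left edge: `cUp t = (0, fUp t)` for `t ≥ ahi - epsHi`.
[folklore] -/
theorem cUp_eq_left {t : ℝ} (ht : b.ahi - b.epsHi ≤ t) : b.cUp t = pt2 0 (b.fUp t) := by
  have h := b.cUpAux_spec.2.1 (-t) (by linarith)
  ext i
  fin_cases i
  · simp [cUp, h, pt2_apply_zero]
  · simp [cUp, h, pt2_apply_one, neg_neg]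

/-- Near `thi` the upper arch runs down the right edge: `cUp t = (1, gUp t)` for `t ≤ thi + epsHi`.
[folklore] -/
theorem cUp_eq_right {t : ℝ} (ht : t ≤ b.thi + b.epsHi) : b.cUp t = pt2 1 (b.gUp t) := by
  have h := b.cUpAux_spec.2.2.1 (-t) (by linarith)
  ext i
  fin_cases i
  · simp [cUp, h, pt2_apply_zero]
  · simp [cUp, h, pt2_apply_one, neg_neg]

/-- Strictly between the marks the upper arch is off the two edges. [folklore] -/
theorem cUp_zero_mem_Ioo {t : ℝ} (ht : t ∈ Ioo (b.thi + b.epsHi) (b.ahi - b.epsHi)) :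
    b.cUp t 0 ∈ Ioo (0 : ℝ) 1 :=
  b.cUpAux_spec.2.2.2.1 (-t) ⟨by linarith [ht.2], by linarith [ht.1]⟩

/-- The first coordinate of the upper arch lies in `[0, 1]`. [folklore] -/
theorem cUp_zero_mem_Icc (t : ℝ) : b.cUp t 0 ∈ Icc (0 : ℝ) 1 := b.cUpAux_spec.2.2.2.2.1 (-t)

/-- The height of the upper arch lies between `gUp t` and `fUp t`. [folklore] -/
theorem cUp_one_mem_uIcc (t : ℝ) : b.cUp t 1 ∈ uIcc (b.gUp t) (b.fUp t) := by
  have h := b.cUpAux_spec.2.2.2.2.2.1 (-t)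
  simp only [neg_neg] at h
  rw [cUp_apply_one, mem_uIcc] at *
  rcases h with h | h
  · left; constructor <;> linarith [h.1, h.2]
  · right; constructor <;> linarith [h.1, h.2]

/-- The upper arch is injective. [folklore] -/
theorem injective_cUp : Injective b.cUp := by
  intro s t hst
  have h0 : b.cUpAux (-s) 0 = b.cUpAux (-t) 0 := by rw [← cUp_apply_zero, ← cUp_apply_zero, hst]
  have h1 : b.cUpAux (-s) 1 = b.cUpAux (-t) 1 := by
    have := congrArg (fun x : 𝔼 2 ↦ x 1) hst
    simpa using this
  have : b.cUpAux (-s) = b.cUpAux (-t) := by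
    ext i; fin_cases i <;> assumption
  exact neg_injective (b.cUpAux_spec.2.2.2.2.2.2.1 this)

/-- Coordinates of the derivative of a planar curve. [folklore] -/
theorem deriv_apply_eq {c : ℝ → 𝔼 2} {s : ℝ} (hc : DifferentiableAt ℝ c s) (i : Fin 2) :
    deriv (fun t ↦ c t i) s = deriv c s i := by
  have := ((EuclideanSpace.proj i : 𝔼 2 →L[ℝ] ℝ).hasFDerivAt.comp_hasDerivAt s hc.hasDerivAt).deriv
  exact this

/-- The upper arch is regular. [folklore] -/
theorem deriv_cUp_ne_zero (t : ℝ) : deriv b.cUp t ≠ 0 := by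
  have hd : Differentiable ℝ b.cUpAux := b.cUpAux_spec.1.differentiable (by simp)
  have hne := b.cUpAux_spec.2.2.2.2.2.2.2 (-t)
  -- derivative of `cUp` in terms of that of `cUpAux`
  have hcomp : HasDerivAt (fun s ↦ b.cUpAux (-s)) ((-1 : ℝ) • deriv b.cUpAux (-t)) t :=
    (hd (-t)).hasDerivAt.scomp t (hasDerivAt_neg t)
  have h0 : HasDerivAt (fun s ↦ b.cUpAux (-s) 0) (-(deriv b.cUpAux (-t) 0)) t := by
    have h' := (EuclideanSpace.proj (0 : Fin 2) : 𝔼 2 →L[ℝ] ℝ).hasFDerivAt.comp_hasDerivAt t hcomp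
    have e : (EuclideanSpace.proj (0 : Fin 2) : 𝔼 2 →L[ℝ] ℝ) ((-1 : ℝ) • deriv b.cUpAux (-t)) =
        -(deriv b.cUpAux (-t) 0) := by simp
    exact e ▸ h'
  have h1 : HasDerivAt (fun s ↦ -(b.cUpAux (-s) 1)) (deriv b.cUpAux (-t) 1) t := by
    have h' := ((EuclideanSpace.proj (1 : Fin 2) : 𝔼 2 →L[ℝ] ℝ).hasFDerivAt.comp_hasDerivAt t hcomp).neg
    have e : -(EuclideanSpace.proj (1 : Fin 2) : 𝔼 2 →L[ℝ] ℝ) ((-1 : ℝ) • deriv b.cUpAux (-t)) =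
        deriv b.cUpAux (-t) 1 := by simp
    exact e ▸ h'
  have hc : HasDerivAt b.cUp (pt2 (-(deriv b.cUpAux (-t) 0)) (deriv b.cUpAux (-t) 1)) t :=
    hasDerivAt_pt2 h0 h1
  rw [hc.deriv]
  intro h
  apply hne
  have e0 : deriv b.cUpAux (-t) 0 = 0 := by
    have := congrArg (fun x : 𝔼 2 ↦ x 0) h; simpa using this
  have e1 : deriv b.cUpAux (-t) 1 = 0 := by
    have := congrArg (fun x : 𝔼 2 ↦ x 1) h; simpa using this
  ext i; fin_cases i
  · exact e0
  · exact e1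

/-- On `[thi, thetaA (17/20)]` the height of the upper arch on the `A`-side is `heightA`, with
values in `[7/10, 17/20]`. [folklore] -/
theorem fUp_eq_heightA {t : ℝ} (ht : t ∈ Icc b.thi (b.thetaA (17 / 20))) :
    b.fUp t = b.heightA t ∧ b.heightA t ∈ Icc (7 / 10 : ℝ) (17 / 20) := by
  have hm := b.marks_lt
  have h1 := b.fUp_spec.2.1 t ⟨by linarith [ht.1], ht.2⟩
  refine ⟨h1, ?_⟩
  have hmono := b.strictMonoOn_heightA.monotoneOn
  have ha : b.heightA (b.thetaA (17 / 20)) = 17 / 20 := b.heightA_thetaA (by norm_num)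
  constructor
  · rw [← b.heightA_marks.2.2.1]
    exact hmono ⟨by linarith, by linarith⟩ ⟨by linarith [ht.1], by linarith [ht.2]⟩ ht.1
  · rw [← ha]
    exact hmono ⟨by linarith [ht.1], by linarith [ht.2]⟩ ⟨by linarith, hm.2.2.2.2.2.2.1.le⟩ ht.2

/-- Above `psiInv (thetaB (17/20) + 1)` the height of the upper arch on the `B`-side lies in
`(3/5, 9/10)`. [folklore] -/
theorem gUp_mem {t : ℝ} (ht : b.psiInv (b.thetaB (17 / 20) + 1) ≤ t) : b.gUp t ∈ Ioo (3 / 5 : ℝ) (9 / 10) := by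
  obtain ⟨u, hu, hgu⟩ := b.gUp_spec.2.2.2.2.2 t ht
  rw [hgu]
  have h1 := b.strictMono_psi hu.1
  have h2 := b.strictMono_psi hu.2
  rw [psi_psiInv] at h1 h2
  have hlt : b.thetaB (3 / 5) < b.thetaB 10⁻¹ :=
    b.strictAntiOn_thetaB (by norm_num) (by norm_num) (by norm_num)
  have hwin : b.psi u - 1 ∈ Icc (b.thetaB (9 / 10)) (b.thetaB 10⁻¹) := ⟨by linarith, by linarith⟩
  have hanti := b.strictAntiOn_heightB
  have e1 : b.heightB (b.thetaB (3 / 5)) = 3 / 5 := b.heightB_thetaB (by norm_num)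
  have e2 : b.heightB (b.thetaB (9 / 10)) = 9 / 10 := b.heightB_thetaB (by norm_num)
  have hm6 : b.thetaB (3 / 5) ∈ Icc (b.thetaB (9 / 10)) (b.thetaB 10⁻¹) :=
    ⟨(b.strictAntiOn_thetaB (by norm_num) (by norm_num) (by norm_num : (3 / 5 : ℝ) < 9 / 10)).le, hlt.le⟩
  have hm9 : b.thetaB (9 / 10) ∈ Icc (b.thetaB (9 / 10)) (b.thetaB 10⁻¹) :=
    ⟨le_rfl, (b.strictAntiOn_thetaB (by norm_num) (by norm_num) (by norm_num : (10⁻¹ : ℝ) < 9 / 10)).le⟩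
  constructor
  · rw [← e1]; exact hanti hwin hm6 (by linarith)
  · rw [← e2]; exact hanti hm9 hwin (by linarith)

/-- **Upper junction with `A`.** For `t ∈ [ahi - epsHi, thetaA (17/20)]`:
`band (cUp t) = A (circlePt t)`. [folklore] -/
theorem band_cUp_eq_A {t : ℝ} (ht : t ∈ Icc (b.ahi - b.epsHi) (b.thetaA (17 / 20))) :
    b.band (b.cUp t) = A (circlePt t) := by
  have hm := b.marks_lt
  obtain ⟨hε, hε1, -⟩ := b.epsHi_bounds
  rw [b.cUp_eq_left ht.1, (b.fUp_eq_heightA ⟨by linarith [ht.1], ht.2⟩).1,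
    b.band_pt2_zero_heightA ⟨by linarith [ht.1], by linarith [ht.2]⟩]

/-- **Upper junction with `B`.** For `t ∈ [psiInv (thetaB (17/20) + 1), thi + epsHi]`:
`band (cUp t) = B (circlePt (psi t))` (one period of `B` later). [folklore] -/
theorem band_cUp_eq_B {t : ℝ} (ht : t ∈ Icc (b.psiInv (b.thetaB (17 / 20) + 1)) (b.thi + b.epsHi)) :
    b.band (b.cUp t) = B (circlePt (b.psi t)) := by
  obtain ⟨h1, h2⟩ := b.thi_marksB
  obtain ⟨hε, -, -⟩ := b.epsHi_bounds
  rw [b.cUp_eq_right ht.2, b.gUp_spec.2.1 t ⟨ht.1, by linarith [ht.2]⟩]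
  have hper : circlePt (b.psi t) = circlePt (b.psi t - 1) := by
    conv_lhs => rw [show b.psi t = b.psi t - 1 + 1 by ring, circlePt_add_one]
  rw [hper]
  apply b.band_pt2_one_heightB
  have hs1 := b.strictMono_psi.monotone ht.1
  have hs2 : b.psi t ≤ b.psi (b.psiInv (b.thetaB (13 / 20) + 1)) :=
    b.strictMono_psi.monotone (by linarith [ht.2])
  rw [psi_psiInv] at hs1 hs2
  constructor
  · linarith [b.strictAntiOn_thetaB (by norm_num) (by norm_num) (by norm_num : (17 / 20 : ℝ) < 9 / 10)]
  · linarith [b.strictAntiOn_thetaB (by norm_num) (by norm_num) (by norm_num : (10⁻¹ : ℝ) < 13 / 20)]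

/-- **Heights of the upper arch over `[thi, ahi]`** lie in `(3/5, 9/10)`, and the arch lies in the
square neighbourhood. [folklore] -/
theorem cUp_mem {t : ℝ} (ht : t ∈ Icc b.thi b.ahi) :
    b.cUp t ∈ squareNhd b.δ ∧ b.cUp t 1 ∈ Ioo (3 / 5 : ℝ) (9 / 10) := by
  have hm := b.marks_lt
  have hδ := b.δ_pos
  have hx0 := b.cUp_zero_mem_Icc t
  have hx1 := b.cUp_one_mem_uIcc t
  obtain ⟨hf, hfm⟩ := b.fUp_eq_heightA ⟨ht.1, by linarith [ht.2]⟩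
  have hg := b.gUp_mem (b.thi_marksB.1.le.trans ht.1)
  have hx1' : b.cUp t 1 ∈ Ioo (3 / 5 : ℝ) (9 / 10) := by
    rw [hf, mem_uIcc] at hx1
    rcases hx1 with h | h <;> constructor <;> linarith [h.1, h.2, hfm.1, hfm.2, hg.1, hg.2]
  refine ⟨?_, hx1'⟩
  rw [mem_squareNhd_iff, Fin.forall_fin_two]
  exact ⟨⟨by linarith [hx0.1], by linarith [hx0.2]⟩, ⟨by linarith [hx1'.1], by linarith [hx1'.2]⟩⟩

end BandCore

end Literature.Topology.FourManifolds
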